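import Literature.Probability.RandomPlanarGeometry.SAWPulledLargeForceExpansionZdTwoSlack
import Literature.Probability.RandomPlanarGeometry.SAWPulledLargeForceExpansionZdFourthOrder
import HarnessLib

/-!
# The two-slack layer of the pulled large-force expansion on `ℤ^{d+1}`: the fibres and the closed form

Topic `Literature/Probability/RandomPlanarGeometry` (continues `SAWPulledLargeForceExpansionZdTwoSlack.lean`: the layer
`N_{2A+2,3A+2}(ℤ^{d+1})` is the disjoint union of the table-driven families `flatWalk`, so that
`costCoeffZd d (2A+2) (3A+2) = Σ_f #admS(f) + Σ_P #admB(P)`; and `…ZdFourthOrder.lean`: the index sets `nonrevFour`,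
`squareFour`, the four-vector lemma).

THIS FILE evaluates the fibres. A member `flatWalk d n R f u` is self-avoiding iff the transverse steps `u = (u₁,u₂,u₃,u₄)` have
non-zero sum over every REALIZED BLOCK — a block `u_{c+1} + u_{c+2}` is realized (`Occ2 R L f c`) iff the reduced-position segments
`c` and `c + 2` (between consecutive flats) carry a common height of the reduced word `R`, the block `u₁+u₂+u₃+u₄` (`Occ4`) iff the
first and the last segment do; single steps and triples never vanish. [The rule for the staple word and the class sums are the sequel
sections of this file.]

## Contents (namespace `Literature.Probability.RandomPlanarGeometry.SAW.Zd.TwoSlack`)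
`rho`, `InSeg`, `Occ2`, `Occ4`, `SegInj`, `Good`; ★ `mem_saws_iff_good` (generic). Lane «pcv-sawmu» (a-p3 g17, 2026-08-25).
[cite: MadrasSlade1993, §4.2, remark after Theorem 4.2.4 (p. 94)] [cite: DuminilCopinHammond2013, §2.2]
-/

noncomputable section

open Finset Literature.Probability.LatticeModels SimpleGraph
open scoped BigOperators
open Literature.Probability.RandomPlanarGeometry.SAW

namespace Literature.Probability.RandomPlanarGeometry.SAW.Zd

namespace TwoSlack

/-! ### Reduced positions of the flats and the five segments -/

/-- The reduced position of flat number `k` (`k = 0,1,2,3`): `f_k − k`. [cite: MadrasSlade1993, §4.2, remark after Theorem 4.2.4 (p. 94)] -/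
def rho (f : ℕ × ℕ × ℕ × ℕ) (k : ℕ) : ℕ :=
  if k = 0 then f.1 else if k = 1 then f.2.1 - 1 else if k = 2 then f.2.2.1 - 2 else f.2.2.2 - 3

/-- Segment `c` (`c = 0, …, 4`) of reduced positions: `[0, ρ₀]`, `[ρ₀, ρ₁]`, `[ρ₁, ρ₂]`, `[ρ₂, ρ₃]`, `[ρ₃, L]` — the positions visited
after exactly `c` transverse steps. [cite: MadrasSlade1993, §4.2, remark after Theorem 4.2.4 (p. 94)] -/
def InSeg (L : ℕ) (f : ℕ × ℕ × ℕ × ℕ) (c p : ℕ) : Prop := (1 ≤ c → rho f (c - 1) ≤ p) ∧ (c ≤ 3 → p ≤ rho f c) ∧ p ≤ L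

/-- The block `u_{c+1} + u_{c+2}` is realized: segments `c` and `c + 2` share a height. [cite: MadrasSlade1993, §4.2, remark after Theorem 4.2.4 (p. 94)] -/
def Occ2 (R : ℕ → ℕ) (L : ℕ) (f : ℕ × ℕ × ℕ × ℕ) (c : ℕ) : Prop := ∃ p q, InSeg L f c p ∧ InSeg L f (c + 2) q ∧ R p = R q

/-- The block `u₁ + u₂ + u₃ + u₄` is realized: the first and the last segment share a height. [cite: MadrasSlade1993, §4.2, remark after Theorem 4.2.4 (p. 94)] -/
def Occ4 (R : ℕ → ℕ) (L : ℕ) (f : ℕ × ℕ × ℕ × ℕ) : Prop := ∃ p q, InSeg L f 0 p ∧ InSeg L f 4 q ∧ R p = R q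

/-- The reduced word takes each height at most once on each segment (segments lie inside monotone runs). [cite: MadrasSlade1993, §4.2, remark after Theorem 4.2.4 (p. 94)] -/
def SegInj (R : ℕ → ℕ) (L : ℕ) (f : ℕ × ℕ × ℕ × ℕ) : Prop := ∀ c p q, InSeg L f c p → InSeg L f c q → R p = R q → p = q

/-- The block constraints on the transverse data. [cite: MadrasSlade1993, §4.2, remark after Theorem 4.2.4 (p. 94)] -/
def Good (d : ℕ) (R : ℕ → ℕ) (L : ℕ) (f : ℕ × ℕ × ℕ × ℕ) (u : Steps d) : Prop :=
  (Occ2 R L f 0 → u.2.1 ≠ revIdx u.1) ∧ (Occ2 R L f 1 → u.2.2.1 ≠ revIdx u.2.1) ∧ (Occ2 R L f 2 → u.2.2.2 ≠ revIdx u.2.2.1) ∧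
    (Occ4 R L f → psum4 d u 4 ≠ 0)

section generic3

variable {d n A L : ℕ} {R : ℕ → ℕ} {f : ℕ × ℕ × ℕ × ℕ}

/-- The values of `rho`. [cite: MadrasSlade1993, §4.2, remark after Theorem 4.2.4 (p. 94)] -/
theorem rho_vals (f : ℕ × ℕ × ℕ × ℕ) : rho f 0 = f.1 ∧ rho f 1 = f.2.1 - 1 ∧ rho f 2 = f.2.2.1 - 2 ∧ rho f 3 = f.2.2.2 - 3 := by
  simp [rho]

/-- The position reached at time `t ≤ n` lies in the segment numbered by the transverse steps taken so far. [cite: MadrasSlade1993, §4.2, remark after Theorem 4.2.4 (p. 94)] -/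
theorem inSeg_cnt (hf : IsFlats n f) (hn : n = L + 4) {t : ℕ} (ht : t ≤ n) : InSeg L f (cnt f t) (t - cnt f t) := by
  have e := cnt_eq hf t
  obtain ⟨r0, r1, r2, r3⟩ := rho_vals f
  obtain ⟨h1, h2, h3, h4, h5⟩ := hf
  refine ⟨fun hc => ?_, fun hc => ?_, by split_ifs at e <;> omega⟩
  · split_ifs at e with g1 g2 g3 g4 <;> rw [e] at hc ⊢
    · omega
    · rw [show 1 - 1 = 0 from rfl, r0]; omega
    · rw [show 2 - 1 = 1 from rfl, r1]; omega
    · rw [show 3 - 1 = 2 from rfl, r2]; omega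
    · rw [show 4 - 1 = 3 from rfl, r3]; omega
  · split_ifs at e with g1 g2 g3 g4 <;> rw [e] at hc ⊢
    · rw [r0]; omega
    · rw [r1]; omega
    · rw [r2]; omega
    · rw [r3]; omega
    · omega

/-- Conversely a position `p` of segment `c` is reached at time `p + c ≤ n` with `c` transverse steps taken. [cite: MadrasSlade1993, §4.2, remark after Theorem 4.2.4 (p. 94)] -/
theorem cnt_of_inSeg (hf : IsFlats n f) (hn : n = L + 4) {c p : ℕ} (hc : c ≤ 4) (hp : InSeg L f c p) :
    p + c ≤ n ∧ cnt f (p + c) = c := by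
  obtain ⟨hlo, hhi, hL⟩ := hp
  obtain ⟨r0, r1, r2, r3⟩ := rho_vals f
  have e := cnt_eq hf (p + c)
  obtain ⟨h1, h2, h3, h4, h5⟩ := hf
  interval_cases c
  · have := hhi (by omega); rw [r0] at this
    refine ⟨by omega, ?_⟩; rw [e]; rw [if_pos (by omega)]
  · have a1 := hlo le_rfl; have a2 := hhi (by omega); rw [show 1 - 1 = 0 from rfl, r0] at a1; rw [r1] at a2
    refine ⟨by omega, ?_⟩; rw [e, if_neg (by omega), if_pos (by omega)]
  · have a1 := hlo (by omega); have a2 := hhi (by omega); rw [show 2 - 1 = 1 from rfl, r1] at a1; rw [r2] at a2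
    refine ⟨by omega, ?_⟩; rw [e, if_neg (by omega), if_neg (by omega), if_pos (by omega)]
  · have a1 := hlo (by omega); have a2 := hhi le_rfl; rw [show 3 - 1 = 2 from rfl, r2] at a1; rw [r3] at a2
    refine ⟨by omega, ?_⟩; rw [e, if_neg (by omega), if_neg (by omega), if_neg (by omega), if_pos (by omega)]
  · have a1 := hlo (by omega); rw [show 4 - 1 = 3 from rfl, r3] at a1
    refine ⟨by omega, ?_⟩; rw [e, if_neg (by omega), if_neg (by omega), if_neg (by omega), if_neg (by omega)]

/-- The reduced flat positions are sorted. [cite: MadrasSlade1993, §4.2, remark after Theorem 4.2.4 (p. 94)] -/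
theorem rho_mono (hf : IsFlats n f) {i j : ℕ} (hij : i ≤ j) (hj : j ≤ 3) : rho f i ≤ rho f j := by
  obtain ⟨r0, r1, r2, r3⟩ := rho_vals f
  obtain ⟨h1, h2, h3, h4, h5⟩ := hf
  interval_cases j <;> interval_cases i <;> omega

/-- Segments are ordered: a position of segment `c` is at most any position of a later segment. [cite: MadrasSlade1993, §4.2, remark after Theorem 4.2.4 (p. 94)] -/
theorem le_of_inSeg (hf : IsFlats n f) {c p q : ℕ} (hp : InSeg L f c p) (k : ℕ) (hk : 1 ≤ k) (hq : InSeg L f (c + k) q) (hc : c ≤ 3) : p ≤ q := by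
  obtain ⟨-, hhi, -⟩ := hp
  obtain ⟨hlo, -, -⟩ := hq
  have a := hhi hc
  have b := hlo (by omega)
  have hle : c ≤ c + k - 1 := by omega
  rcases Nat.lt_or_ge (c + k - 1) 4 with h4 | h4
  · have := rho_mono hf hle (by omega)
    omega
  · -- `c + k − 1 ≥ 4` cannot index a flat; but then `hlo` is about `rho f (c + k - 1)` with the default branch
    have : rho f (c + k - 1) = f.2.2.2 - 3 := by
      simp only [rho]; rw [if_neg (by omega), if_neg (by omega), if_neg (by omega)]
    have h3 := rho_mono hf hc le_rfl
    obtain ⟨-, -, -, r3⟩ := rho_vals f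
    omega

/-- `cnt` is monotone in time. [cite: MadrasSlade1993, §4.2, remark after Theorem 4.2.4 (p. 94)] -/
theorem cnt_mono (f : ℕ × ℕ × ℕ × ℕ) {s t : ℕ} (hst : s ≤ t) : cnt f s ≤ cnt f t := by
  simp only [cnt]; split_ifs <;> omega

/-- The partial sums beyond `c` transverse steps. [cite: MadrasSlade1993, Definition 1.2.4] -/
theorem psum4_add (d : ℕ) (u : Steps d) (c : ℕ) :
    (c ≤ 3 → psum4 d u (c + 1) = psum4 d u c + twoStepV d (nth d u c)) ∧
    (c ≤ 2 → psum4 d u (c + 2) = psum4 d u c + twoStepV d (nth d u c) + twoStepV d (nth d u (c + 1))) ∧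
    (c ≤ 1 → psum4 d u (c + 3) = psum4 d u c + twoStepV d (nth d u c) + twoStepV d (nth d u (c + 1)) + twoStepV d (nth d u (c + 2))) := by
  refine ⟨fun hc => ?_, fun hc => ?_, fun hc => ?_⟩
  · interval_cases c <;> simp [psum4, nth]
  · interval_cases c <;> simp [psum4, nth, add_assoc]
  · interval_cases c <;> simp [psum4, nth, add_assoc]

/-- Equality of two sites of `flatWalk` splits into heights and transverse parts. [cite: MadrasSlade1993, Definition 1.2.4] -/
theorem eq_parts_of_eq {u : Steps d} {s t : ℕ} (hs : s ≤ n) (ht : t ≤ n) (h : flatWalk d n R f u s = flatWalk d n R f u t) :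
    R (s - cnt f s) = R (t - cnt f t) ∧ psum4 d u (cnt f s) = psum4 d u (cnt f t) := by
  have hh : R (s - cnt f s) = R (t - cnt f t) := by
    have := congrFun h 0
    rw [flatWalk_height u hs, flatWalk_height u ht] at this
    exact_mod_cast this
  refine ⟨hh, ?_⟩
  have h' := h
  simp only [flatWalk, min_eq_left hs, min_eq_left ht, hh] at h'
  exact add_left_cancel h'

/-- ★ **Self-avoidance of a table-driven walk = the block constraints on its transverse steps** (for a reduced word injective on
segments). [cite: MadrasSlade1993, §4.2, remark after Theorem 4.2.4 (p. 94)] -/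
theorem mem_saws_iff_good (hf : IsFlats n f) (hn : n = L + 4) (hR : IsRedWord A L R) (hinj : SegInj R L f) (u : Steps d) :
    flatWalk d n R f u ∈ saws (d + 1) n ↔ Good d R L f u := by
  obtain ⟨n0, n1, n2, n3⟩ := nth_vals d u
  constructor
  · intro hω
    obtain ⟨-, -, -, hωinj⟩ := mem_saws.1 hω
    have hmem : ∀ i : ℕ, i ≤ n → i ∈ {j : ℕ | j ≤ n} := fun i hi => hi
    -- a realized 2-block with a reversal gives two coinciding sites
    have two : ∀ c, c ≤ 2 → Occ2 R L f c → nth d u (c + 1) ≠ revIdx (nth d u c) := by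
      intro c hc ⟨p, q, hp, hq, hR'⟩ hrev
      obtain ⟨hpn, hpc⟩ := cnt_of_inSeg hf hn (by omega) hp
      obtain ⟨hqn, hqc⟩ := cnt_of_inSeg hf hn (by omega) hq
      have hpq : p ≤ q := le_of_inSeg hf hp 2 (by omega) hq (by omega)
      have he : flatWalk d n R f u (p + c) = flatWalk d n R f u (q + (c + 2)) := by
        rw [flatWalk, flatWalk, min_eq_left hpn, min_eq_left hqn, hpc, hqc, Nat.add_sub_cancel, Nat.add_sub_cancel, hR',
          (psum4_add d u c).2.1 hc, hrev, revIdx, twoStepV_not, add_assoc, add_neg_cancel, add_zero]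
      have := hωinj (hmem _ hpn) (hmem _ hqn) he
      omega
    refine ⟨fun h => by have := two 0 (by omega) h; rwa [n1, n0] at this,
      fun h => by have := two 1 (by omega) h; rwa [n2, n1] at this,
      fun h => by have := two 2 (by omega) h; rwa [n3, n2] at this, ?_⟩
    rintro ⟨p, q, hp, hq, hR'⟩ hsum
    obtain ⟨hpn, hpc⟩ := cnt_of_inSeg hf hn (by omega) hp
    obtain ⟨hqn, hqc⟩ := cnt_of_inSeg hf hn le_rfl hq
    have hpq : p ≤ q := le_of_inSeg hf hp 4 (by omega) hq (by omega)
    have he : flatWalk d n R f u (p + 0) = flatWalk d n R f u (q + 4) := by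
      rw [flatWalk, flatWalk, min_eq_left hpn, min_eq_left hqn, hpc, hqc, Nat.add_sub_cancel, Nat.add_sub_cancel, hR', hsum]
      simp [psum4]
    have := hωinj (hmem _ hpn) (hmem _ hqn) he
    omega
  · rintro ⟨g0, g1, g2, g4⟩
    refine mem_saws.2 ⟨?_, fun i hi => flatWalk_of_le d n R f u hi, fun i hi => flatWalk_adj hf hn hR u hi, ?_⟩
    · rw [flatWalk, Nat.zero_min, cnt_zero, Nat.sub_zero, hR.zero]; simp [psum4]
    -- injectivity on `{0, …, n}`
    have key : ∀ s t, s < t → t ≤ n → flatWalk d n R f u s ≠ flatWalk d n R f u t := by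
      intro s t hst htn he
      obtain ⟨hRst, hP⟩ := eq_parts_of_eq (hst.le.trans htn) htn he
      have hcs := inSeg_cnt hf hn (hst.le.trans htn)
      have hct := inSeg_cnt hf hn htn
      have hmono := cnt_mono f hst.le
      have hc4 := cnt_le_four f t
      have hcs_le : cnt f s ≤ s := by
        rcases Nat.eq_zero_or_pos s with rfl | hs0
        · rw [cnt_zero]
        · have := cnt_lt hf hs0; omega
      obtain ⟨k, hk⟩ : ∃ k, cnt f t = cnt f s + k := ⟨cnt f t - cnt f s, by omega⟩
      have hk4 : k ≤ 4 := by omega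
      interval_cases k
      · -- same segment: the word is injective there
        rw [add_zero] at hk
        rw [hk] at hct hRst
        have := hinj _ _ _ hcs hct hRst
        omega
      · rw [hk, (psum4_add d u (cnt f s)).1 (by omega)] at hP
        exact twoStepV_ne_zero d _ (by simpa using hP.symm)
      · rw [hk, (psum4_add d u (cnt f s)).2.1 (by omega), add_assoc] at hP
        have hz := twoStepV_add_eq_zero d (by simpa using hP.symm)
        have hocc : Occ2 R L f (cnt f s) := ⟨_, _, hcs, by rw [← hk]; exact hct, hRst⟩
        have hc2 : cnt f s ≤ 2 := by omega
        interval_cases (cnt f s)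
        · exact g0 hocc (by rw [n0, n1] at hz; exact hz)
        · exact g1 hocc (by rw [n1, n2] at hz; exact hz)
        · exact g2 hocc (by rw [n2, n3] at hz; exact hz)
      · rw [hk, (psum4_add d u (cnt f s)).2.2 (by omega), add_assoc, add_assoc] at hP
        have h0 := add_left_cancel (a := psum4 d u (cnt f s)) (hP.symm.trans (add_zero _).symm)
        exact twoStepV_add_add_ne_zero d _ _ _ (by rw [add_assoc]; exact h0)
      · have hc0 : cnt f s = 0 := by omega
        rw [hc0] at hk hcs hP hRst
        rw [hk] at hct hP hRst
        simp only [zero_add] at hk hct hP hRst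
        rw [Nat.sub_zero] at hRst hcs
        have hocc : Occ4 R L f := ⟨_, _, hcs, hct, hRst⟩
        exact g4 hocc (by rw [← hP]; simp [psum4])
    intro s hs t ht he
    simp only [Set.mem_setOf_eq] at hs ht
    rcases lt_trichotomy s t with hlt | heq | hgt
    · exact absurd he (key s t hlt ht)
    · exact heq
    · exact absurd he.symm (key t s hgt hs)

end generic3


/-! ### The staple word on the six kinds of sorted flat tuples -/

/-- Segment membership in flat-time coordinates `f = (a, b, c, e)`. [cite: MadrasSlade1993, §4.2, remark after Theorem 4.2.4 (p. 94)] -/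
theorem inSeg_iff {L : ℕ} {f : ℕ × ℕ × ℕ × ℕ} {c p : ℕ} : InSeg L f c p ↔
    ((c = 0 → p ≤ f.1) ∧ (c = 1 → f.1 ≤ p ∧ p ≤ f.2.1 - 1) ∧ (c = 2 → f.2.1 - 1 ≤ p ∧ p ≤ f.2.2.1 - 2) ∧
      (c = 3 → f.2.2.1 - 2 ≤ p ∧ p ≤ f.2.2.2 - 3) ∧ (4 ≤ c → f.2.2.2 - 3 ≤ p) ∧ p ≤ L) := by
  obtain ⟨r0, r1, r2, r3⟩ := rho_vals f
  unfold InSeg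
  rcases (show c = 0 ∨ c = 1 ∨ c = 2 ∨ c = 3 ∨ 4 ≤ c by omega) with rfl | rfl | rfl | rfl | hc
  · rw [r0]; omega
  · rw [show 1 - 1 = 0 from rfl, r0, r1]; omega
  · rw [show 2 - 1 = 1 from rfl, r1, r2]; omega
  · rw [show 3 - 1 = 2 from rfl, r2, r3]; omega
  · have : rho f (c - 1) = f.2.2.2 - 3 := by
      simp only [rho]; rw [if_neg (by omega), if_neg (by omega), if_neg (by omega)]
    rw [this]; omega

/-- Sorted flats `(x, y + 1, A + 2, 2 * A + 2)`: the staple word is injective on every segment, and the realized blocks are as listed. [cite: MadrasSlade1993, §4.2, remark after Theorem 4.2.4 (p. 94)] -/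
theorem br1 {A x y : ℕ} (hx1 : 1 ≤ x) (hxy : x ≤ y) (hyA : y < A) :
    SegInj (stapleR A) (3 * A - 2) (x, y + 1, A + 2, 2 * A + 2) ∧
      (Occ2 (stapleR A) (3 * A - 2) (x, y + 1, A + 2, 2 * A + 2) 0 ↔ x = y) ∧ (Occ2 (stapleR A) (3 * A - 2) (x, y + 1, A + 2, 2 * A + 2) 1 ↔ True) ∧
      (Occ2 (stapleR A) (3 * A - 2) (x, y + 1, A + 2, 2 * A + 2) 2 ↔ True) ∧ (Occ4 (stapleR A) (3 * A - 2) (x, y + 1, A + 2, 2 * A + 2) ↔ True) := by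
  refine ⟨?_, ?_, ?_, ?_, ?_⟩
  · intro c p q hp hq h
    rw [inSeg_iff] at hp hq
    simp only at hp hq
    simp only [stapleR] at h
    split_ifs at h <;> omega
  · constructor
    · rintro ⟨p, q, hp, hq, h⟩
      rw [inSeg_iff] at hp hq
      simp only [true_implies] at hp hq
      simp only [stapleR] at h
      split_ifs at h <;> omega
    · intro hc
      refine ⟨x, y, ?_, ?_, ?_⟩
      · rw [inSeg_iff]; simp only [true_implies]; omega
      · rw [inSeg_iff]; simp only [true_implies]; omega
      · simp only [stapleR]; split_ifs <;> omega
  · refine iff_true_intro ⟨x, 2 * A - x, ?_, ?_, ?_⟩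
    · rw [inSeg_iff]; simp only [true_implies]; omega
    · rw [inSeg_iff]; simp only [true_implies]; omega
    · simp only [stapleR]; split_ifs <;> omega
  · refine iff_true_intro ⟨A, 3 * A - 2, ?_, ?_, ?_⟩
    · rw [inSeg_iff]; simp only [true_implies]; omega
    · rw [inSeg_iff]; simp only; omega
    · simp only [stapleR]; split_ifs <;> omega
  · refine iff_true_intro ⟨x, 2 * A - 2 + x, ?_, ?_, ?_⟩
    · rw [inSeg_iff]; simp only [true_implies]; omega
    · rw [inSeg_iff]; simp only; omega
    · simp only [stapleR]; split_ifs <;> omega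

/-- Sorted flats `(x, A + 1, y + 2, 2 * A + 2)`: the staple word is injective on every segment, and the realized blocks are as listed. [cite: MadrasSlade1993, §4.2, remark after Theorem 4.2.4 (p. 94)] -/
theorem br2 {A x y : ℕ} (hx1 : 1 ≤ x) (hxA : x < A) (hAy : A ≤ y) (hy2 : y < 2 * A) :
    SegInj (stapleR A) (3 * A - 2) (x, A + 1, y + 2, 2 * A + 2) ∧
      (Occ2 (stapleR A) (3 * A - 2) (x, A + 1, y + 2, 2 * A + 2) 0 ↔ 2 * A ≤ x + y) ∧ (Occ2 (stapleR A) (3 * A - 2) (x, A + 1, y + 2, 2 * A + 2) 1 ↔ x + y ≤ 2 * A) ∧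
      (Occ2 (stapleR A) (3 * A - 2) (x, A + 1, y + 2, 2 * A + 2) 2 ↔ True) ∧ (Occ4 (stapleR A) (3 * A - 2) (x, A + 1, y + 2, 2 * A + 2) ↔ True) := by
  refine ⟨?_, ?_, ?_, ?_, ?_⟩
  · intro c p q hp hq h
    rw [inSeg_iff] at hp hq
    simp only at hp hq
    simp only [stapleR] at h
    split_ifs at h <;> omega
  · constructor
    · rintro ⟨p, q, hp, hq, h⟩
      rw [inSeg_iff] at hp hq
      simp only [true_implies] at hp hq
      simp only [stapleR] at h
      split_ifs at h <;> omega
    · intro hc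
      refine ⟨x, 2 * A - x, ?_, ?_, ?_⟩
      · rw [inSeg_iff]; simp only [true_implies]; omega
      · rw [inSeg_iff]; simp only [true_implies]; omega
      · simp only [stapleR]; split_ifs <;> omega
  · constructor
    · rintro ⟨p, q, hp, hq, h⟩
      rw [inSeg_iff] at hp hq
      simp only [true_implies] at hp hq
      simp only [stapleR] at h
      split_ifs at h <;> omega
    · intro hc
      refine ⟨x, 2 * A - x, ?_, ?_, ?_⟩
      · rw [inSeg_iff]; simp only [true_implies]; omega
      · rw [inSeg_iff]; simp only [true_implies]; omega
      · simp only [stapleR]; split_ifs <;> omega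
  · refine iff_true_intro ⟨A, 3 * A - 2, ?_, ?_, ?_⟩
    · rw [inSeg_iff]; simp only [true_implies]; omega
    · rw [inSeg_iff]; simp only; omega
    · simp only [stapleR]; split_ifs <;> omega
  · refine iff_true_intro ⟨x, 2 * A - 2 + x, ?_, ?_, ?_⟩
    · rw [inSeg_iff]; simp only [true_implies]; omega
    · rw [inSeg_iff]; simp only; omega
    · simp only [stapleR]; split_ifs <;> omega

/-- Sorted flats `(x, A + 1, 2 * A + 1, y + 3)`: the staple word is injective on every segment, and the realized blocks are as listed. [cite: MadrasSlade1993, §4.2, remark after Theorem 4.2.4 (p. 94)] -/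
theorem br3 {A x y : ℕ} (hx1 : 1 ≤ x) (hxA : x < A) (hy2 : 2 * A ≤ y) (hyL : y ≤ 3 * A - 2) :
    SegInj (stapleR A) (3 * A - 2) (x, A + 1, 2 * A + 1, y + 3) ∧
      (Occ2 (stapleR A) (3 * A - 2) (x, A + 1, 2 * A + 1, y + 3) 0 ↔ True) ∧ (Occ2 (stapleR A) (3 * A - 2) (x, A + 1, 2 * A + 1, y + 3) 1 ↔ x + 2 * A ≤ y + 2) ∧
      (Occ2 (stapleR A) (3 * A - 2) (x, A + 1, 2 * A + 1, y + 3) 2 ↔ True) ∧ (Occ4 (stapleR A) (3 * A - 2) (x, A + 1, 2 * A + 1, y + 3) ↔ y + 2 ≤ x + 2 * A) := by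
  refine ⟨?_, ?_, ?_, ?_, ?_⟩
  · intro c p q hp hq h
    rw [inSeg_iff] at hp hq
    simp only at hp hq
    simp only [stapleR] at h
    split_ifs at h <;> omega
  · refine iff_true_intro ⟨x, 2 * A - x, ?_, ?_, ?_⟩
    · rw [inSeg_iff]; simp only [true_implies]; omega
    · rw [inSeg_iff]; simp only [true_implies]; omega
    · simp only [stapleR]; split_ifs <;> omega
  · constructor
    · rintro ⟨p, q, hp, hq, h⟩
      rw [inSeg_iff] at hp hq
      simp only [true_implies] at hp hq
      simp only [stapleR] at h
      split_ifs at h <;> omega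
    · intro hc
      refine ⟨x, x + 2 * A - 2, ?_, ?_, ?_⟩
      · rw [inSeg_iff]; simp only [true_implies]; omega
      · rw [inSeg_iff]; simp only [true_implies]; omega
      · simp only [stapleR]; split_ifs <;> omega
  · refine iff_true_intro ⟨A, 3 * A - 2, ?_, ?_, ?_⟩
    · rw [inSeg_iff]; simp only [true_implies]; omega
    · rw [inSeg_iff]; simp only; omega
    · simp only [stapleR]; split_ifs <;> omega
  · constructor
    · rintro ⟨p, q, hp, hq, h⟩
      rw [inSeg_iff] at hp hq
      simp only [true_implies] at hp hq
      simp only [stapleR] at h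
      split_ifs at h <;> omega
    · intro hc
      refine ⟨x, x + 2 * A - 2, ?_, ?_, ?_⟩
      · rw [inSeg_iff]; simp only [true_implies]; omega
      · rw [inSeg_iff]; simp only; omega
      · simp only [stapleR]; split_ifs <;> omega

/-- Sorted flats `(A, x + 1, y + 2, 2 * A + 2)`: the staple word is injective on every segment, and the realized blocks are as listed. [cite: MadrasSlade1993, §4.2, remark after Theorem 4.2.4 (p. 94)] -/
theorem br4 {A x y : ℕ} (hAx : A ≤ x) (hxy : x ≤ y) (hy2 : y < 2 * A) (hA : 2 ≤ A) :
    SegInj (stapleR A) (3 * A - 2) (A, x + 1, y + 2, 2 * A + 2) ∧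
      (Occ2 (stapleR A) (3 * A - 2) (A, x + 1, y + 2, 2 * A + 2) 0 ↔ True) ∧ (Occ2 (stapleR A) (3 * A - 2) (A, x + 1, y + 2, 2 * A + 2) 1 ↔ x = y) ∧
      (Occ2 (stapleR A) (3 * A - 2) (A, x + 1, y + 2, 2 * A + 2) 2 ↔ True) ∧ (Occ4 (stapleR A) (3 * A - 2) (A, x + 1, y + 2, 2 * A + 2) ↔ True) := by
  refine ⟨?_, ?_, ?_, ?_, ?_⟩
  · intro c p q hp hq h
    rw [inSeg_iff] at hp hq
    simp only at hp hq
    simp only [stapleR] at h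
    split_ifs at h <;> omega
  · refine iff_true_intro ⟨2 * A - x, x, ?_, ?_, ?_⟩
    · rw [inSeg_iff]; simp only [true_implies]; omega
    · rw [inSeg_iff]; simp only [true_implies]; omega
    · simp only [stapleR]; split_ifs <;> omega
  · constructor
    · rintro ⟨p, q, hp, hq, h⟩
      rw [inSeg_iff] at hp hq
      simp only [true_implies] at hp hq
      simp only [stapleR] at h
      split_ifs at h <;> omega
    · intro hc
      refine ⟨x, y, ?_, ?_, ?_⟩
      · rw [inSeg_iff]; simp only [true_implies]; omega
      · rw [inSeg_iff]; simp only [true_implies]; omega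
      · simp only [stapleR]; split_ifs <;> omega
  · refine iff_true_intro ⟨x, 4 * A - 2 - x, ?_, ?_, ?_⟩
    · rw [inSeg_iff]; simp only [true_implies]; omega
    · rw [inSeg_iff]; simp only; omega
    · simp only [stapleR]; split_ifs <;> omega
  · refine iff_true_intro ⟨A, 3 * A - 2, ?_, ?_, ?_⟩
    · rw [inSeg_iff]; simp only [true_implies]; omega
    · rw [inSeg_iff]; simp only; omega
    · simp only [stapleR]; split_ifs <;> omega

/-- Sorted flats `(A, x + 1, 2 * A + 1, y + 3)`: the staple word is injective on every segment, and the realized blocks are as listed. [cite: MadrasSlade1993, §4.2, remark after Theorem 4.2.4 (p. 94)] -/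
theorem br5 {A x y : ℕ} (hAx : A ≤ x) (hx2 : x < 2 * A) (hy2 : 2 * A ≤ y) (hyL : y ≤ 3 * A - 2) (hA : 2 ≤ A) :
    SegInj (stapleR A) (3 * A - 2) (A, x + 1, 2 * A + 1, y + 3) ∧
      (Occ2 (stapleR A) (3 * A - 2) (A, x + 1, 2 * A + 1, y + 3) 0 ↔ True) ∧ (Occ2 (stapleR A) (3 * A - 2) (A, x + 1, 2 * A + 1, y + 3) 1 ↔ 4 * A ≤ x + y + 2) ∧
      (Occ2 (stapleR A) (3 * A - 2) (A, x + 1, 2 * A + 1, y + 3) 2 ↔ x + y + 2 ≤ 4 * A) ∧ (Occ4 (stapleR A) (3 * A - 2) (A, x + 1, 2 * A + 1, y + 3) ↔ True) := by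
  refine ⟨?_, ?_, ?_, ?_, ?_⟩
  · intro c p q hp hq h
    rw [inSeg_iff] at hp hq
    simp only at hp hq
    simp only [stapleR] at h
    split_ifs at h <;> omega
  · refine iff_true_intro ⟨1, 2 * A - 1, ?_, ?_, ?_⟩
    · rw [inSeg_iff]; simp only [true_implies]; omega
    · rw [inSeg_iff]; simp only [true_implies]; omega
    · simp only [stapleR]; split_ifs <;> omega
  · constructor
    · rintro ⟨p, q, hp, hq, h⟩
      rw [inSeg_iff] at hp hq
      simp only [true_implies] at hp hq
      simp only [stapleR] at h
      split_ifs at h <;> omega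
    · intro hc
      refine ⟨x, 4 * A - 2 - x, ?_, ?_, ?_⟩
      · rw [inSeg_iff]; simp only [true_implies]; omega
      · rw [inSeg_iff]; simp only [true_implies]; omega
      · simp only [stapleR]; split_ifs <;> omega
  · constructor
    · rintro ⟨p, q, hp, hq, h⟩
      rw [inSeg_iff] at hp hq
      simp only [true_implies] at hp hq
      simp only [stapleR] at h
      split_ifs at h <;> omega
    · intro hc
      refine ⟨4 * A - 2 - y, y, ?_, ?_, ?_⟩
      · rw [inSeg_iff]; simp only [true_implies]; omega
      · rw [inSeg_iff]; simp only; omega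
      · simp only [stapleR]; split_ifs <;> omega
  · refine iff_true_intro ⟨A, 3 * A - 2, ?_, ?_, ?_⟩
    · rw [inSeg_iff]; simp only [true_implies]; omega
    · rw [inSeg_iff]; simp only; omega
    · simp only [stapleR]; split_ifs <;> omega

/-- Sorted flats `(A, 2 * A, x + 2, y + 3)`: the staple word is injective on every segment, and the realized blocks are as listed. [cite: MadrasSlade1993, §4.2, remark after Theorem 4.2.4 (p. 94)] -/
theorem br6 {A x y : ℕ} (hx2 : 2 * A ≤ x) (hxy : x ≤ y) (hyL : y ≤ 3 * A - 2) (hA : 2 ≤ A) :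
    SegInj (stapleR A) (3 * A - 2) (A, 2 * A, x + 2, y + 3) ∧
      (Occ2 (stapleR A) (3 * A - 2) (A, 2 * A, x + 2, y + 3) 0 ↔ True) ∧ (Occ2 (stapleR A) (3 * A - 2) (A, 2 * A, x + 2, y + 3) 1 ↔ True) ∧
      (Occ2 (stapleR A) (3 * A - 2) (A, 2 * A, x + 2, y + 3) 2 ↔ x = y) ∧ (Occ4 (stapleR A) (3 * A - 2) (A, 2 * A, x + 2, y + 3) ↔ True) := by
  refine ⟨?_, ?_, ?_, ?_, ?_⟩
  · intro c p q hp hq h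
    rw [inSeg_iff] at hp hq
    simp only at hp hq
    simp only [stapleR] at h
    split_ifs at h <;> omega
  · refine iff_true_intro ⟨1, 2 * A - 1, ?_, ?_, ?_⟩
    · rw [inSeg_iff]; simp only [true_implies]; omega
    · rw [inSeg_iff]; simp only [true_implies]; omega
    · simp only [stapleR]; split_ifs <;> omega
  · refine iff_true_intro ⟨4 * A - 2 - x, x, ?_, ?_, ?_⟩
    · rw [inSeg_iff]; simp only [true_implies]; omega
    · rw [inSeg_iff]; simp only [true_implies]; omega
    · simp only [stapleR]; split_ifs <;> omega
  · constructor
    · rintro ⟨p, q, hp, hq, h⟩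
      rw [inSeg_iff] at hp hq
      simp only [true_implies] at hp hq
      simp only [stapleR] at h
      split_ifs at h <;> omega
    · intro hc
      refine ⟨x, y, ?_, ?_, ?_⟩
      · rw [inSeg_iff]; simp only [true_implies]; omega
      · rw [inSeg_iff]; simp only; omega
      · simp only [stapleR]; split_ifs <;> omega
  · refine iff_true_intro ⟨A, 3 * A - 2, ?_, ?_, ?_⟩
    · rw [inSeg_iff]; simp only [true_implies]; omega
    · rw [inSeg_iff]; simp only; omega
    · simp only [stapleR]; split_ifs <;> omega


/-! ### The free pair `(x, y)`: regime-(i) flat tuples are sorted insertions of `{A, 2A−1}` into a pair `1 ≤ x ≤ y ≤ 3A−2` -/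

/-- `IsFlats` on a literal tuple. [cite: MadrasSlade1993, §4.2, remark after Theorem 4.2.4 (p. 94)] -/
theorem isFlats_mk {n a b c e : ℕ} : IsFlats n (a, b, c, e) ↔ 1 ≤ a ∧ a < b ∧ b < c ∧ c < e ∧ e < n := Iff.rfl

/-- `PinA` on a literal tuple. [cite: MadrasSlade1993, §4.2, remark after Theorem 4.2.4 (p. 94)] -/
theorem pinA_mk {A a b c e : ℕ} : PinA A (a, b, c, e) ↔ a = A ∨ b = A + 1 ∨ c = A + 2 ∨ e = A + 3 := Iff.rfl

/-- `PinV` on a literal tuple. [cite: MadrasSlade1993, §4.2, remark after Theorem 4.2.4 (p. 94)] -/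
theorem pinV_mk {A a b c e : ℕ} : PinV A (a, b, c, e) ↔ a = 2 * A - 1 ∨ b = 2 * A ∨ c = 2 * A + 1 ∨ e = 2 * A + 2 := Iff.rfl

/-- The free pairs `1 ≤ x ≤ y ≤ 3A − 2` (reduced positions of the two free plateaus). [cite: MadrasSlade1993, §4.2, remark after Theorem 4.2.4 (p. 94)] -/
def freePairs (A : ℕ) : Finset (ℕ × ℕ) :=
  (Finset.Icc 1 (3 * A - 2) ×ˢ Finset.Icc 1 (3 * A - 2)).filter fun t => t.1 ≤ t.2

/-- Membership in `freePairs`. [cite: MadrasSlade1993, §4.2, remark after Theorem 4.2.4 (p. 94)] -/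
theorem mem_freePairs {A x y : ℕ} : (x, y) ∈ freePairs A ↔ 1 ≤ x ∧ x ≤ y ∧ y ≤ 3 * A - 2 := by
  simp only [freePairs, Finset.mem_filter, Finset.mem_product, Finset.mem_Icc]
  omega

/-- The flat times of the staple walk with free plateaus at the reduced positions `x ≤ y` (sorted insertion of `A`, `2A − 1`).
[cite: MadrasSlade1993, §4.2, remark after Theorem 4.2.4 (p. 94)] -/
def phi (A : ℕ) : ℕ × ℕ → ℕ × ℕ × ℕ × ℕ
  | (x, y) =>
    if y < A then (x, y + 1, A + 2, 2 * A + 2)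
    else if x < A then (if y < 2 * A then (x, A + 1, y + 2, 2 * A + 2) else (x, A + 1, 2 * A + 1, y + 3))
    else if y < 2 * A then (A, x + 1, y + 2, 2 * A + 2)
    else if x < 2 * A then (A, x + 1, 2 * A + 1, y + 3)
    else (A, 2 * A, x + 2, y + 3)

/-- The inverse: remove one plateau at `A` and one at `2A − 1`. [cite: MadrasSlade1993, §4.2, remark after Theorem 4.2.4 (p. 94)] -/
def psi (A : ℕ) : ℕ × ℕ × ℕ × ℕ → ℕ × ℕ
  | (a, b, c, e) =>
    if a = A then (if b = 2 * A then (c - 2, e - 3) else if c = 2 * A + 1 then (b - 1, e - 3) else (b - 1, c - 2))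
    else if b = A + 1 then (if c = 2 * A + 1 then (a, e - 3) else (a, c - 2))
    else (a, b - 1)

/-- `phi` maps free pairs to regime-(i) flat tuples. [cite: MadrasSlade1993, §4.2, remark after Theorem 4.2.4 (p. 94)] -/
theorem phi_mem {A : ℕ} (hA : 2 ≤ A) {t : ℕ × ℕ} (ht : t ∈ freePairs A) : phi A t ∈ stapleFlats A := by
  obtain ⟨x, y⟩ := t
  rw [mem_freePairs] at ht
  rw [mem_stapleFlats]
  simp only [phi]
  split_ifs <;> rw [isFlats_mk, pinA_mk, pinV_mk] <;> omega

/-- `psi` maps regime-(i) flat tuples to free pairs and `phi ∘ psi = id` there. [cite: MadrasSlade1993, §4.2, remark after Theorem 4.2.4 (p. 94)] -/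
theorem psi_mem_phi_psi {A : ℕ} (hA : 2 ≤ A) {f : ℕ × ℕ × ℕ × ℕ} (hf : f ∈ stapleFlats A) :
    psi A f ∈ freePairs A ∧ phi A (psi A f) = f := by
  obtain ⟨a, b, c, e⟩ := f
  rw [mem_stapleFlats, isFlats_mk, pinA_mk, pinV_mk] at hf
  simp only [psi]
  split_ifs
  all_goals
    constructor
    · rw [mem_freePairs]; omega
    · simp only [phi]; split_ifs <;> simp only [Prod.mk.injEq, true_and] <;> omega

/-- `psi ∘ phi = id` on free pairs. [cite: MadrasSlade1993, §4.2, remark after Theorem 4.2.4 (p. 94)] -/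
theorem psi_phi {A : ℕ} (hA : 2 ≤ A) {t : ℕ × ℕ} (ht : t ∈ freePairs A) : psi A (phi A t) = t := by
  obtain ⟨x, y⟩ := t
  rw [mem_freePairs] at ht
  simp only [phi]
  split_ifs <;> simp only [psi] <;> split_ifs <;> simp only [Prod.mk.injEq, true_and] <;> omega

/-- Sums over regime-(i) flat tuples are sums over free pairs. [cite: MadrasSlade1993, §4.2, remark after Theorem 4.2.4 (p. 94)] -/
theorem sum_stapleFlats_eq_sum_freePairs {A : ℕ} (hA : 2 ≤ A) (g : ℕ × ℕ × ℕ × ℕ → ℕ) :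
    ∑ f ∈ stapleFlats A, g f = ∑ t ∈ freePairs A, g (phi A t) := by
  refine Finset.sum_nbij' (psi A) (phi A) (fun f hf => (psi_mem_phi_psi hA hf).1) (fun t ht => phi_mem hA ht)
    (fun f hf => (psi_mem_phi_psi hA hf).2) (fun t ht => psi_phi hA ht) (fun f hf => ?_)
  rw [(psi_mem_phi_psi hA hf).2]

/-- `2 Σ_{x=1}^{n} (n + 1 − x) = n (n + 1)`. [cite: MadrasSlade1993, §4.2, remark after Theorem 4.2.4 (p. 94)] -/
theorem two_mul_sum_Icc_sub (n : ℕ) : 2 * ∑ x ∈ Finset.Icc 1 n, (n + 1 - x) = n * (n + 1) := by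
  induction n with
  | zero => simp
  | succ n ih =>
    rw [Finset.sum_Icc_succ_top (by omega)]
    have : ∑ x ∈ Finset.Icc 1 n, (n + 1 + 1 - x) = ∑ x ∈ Finset.Icc 1 n, ((n + 1 - x) + 1) :=
      Finset.sum_congr rfl fun x hx => by have := Finset.mem_Icc.1 hx; omega
    rw [this, Finset.sum_add_distrib, Finset.sum_const, Nat.card_Icc, smul_eq_mul, mul_add, mul_add, ih]
    have h1 : n + 1 + 1 - (n + 1) = 1 := by omega
    have h2 : n + 1 - 1 = n := by omega
    rw [h1, h2]; ring

/-- `#freePairs A = (3A − 2)(3A − 1)/2`, stated without division. [cite: MadrasSlade1993, §4.2, remark after Theorem 4.2.4 (p. 94)] -/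
theorem two_mul_card_freePairs (A : ℕ) : 2 * (freePairs A).card = (3 * A - 2) * (3 * A - 1) := by
  set L := 3 * A - 2 with hL
  have heq : freePairs A = (Finset.Icc 1 L).biUnion fun x => (Finset.Icc x L).image fun y => (x, y) := by
    ext ⟨x, y⟩
    simp only [mem_freePairs, Finset.mem_biUnion, Finset.mem_image, Finset.mem_Icc, Prod.mk.injEq]
    constructor
    · rintro ⟨h1, h2, h3⟩; exact ⟨x, ⟨h1, by omega⟩, y, ⟨h2, h3⟩, rfl, rfl⟩
    · rintro ⟨x', ⟨h1, h2⟩, y', ⟨h3, h4⟩, rfl, rfl⟩; exact ⟨h1, h3, h4⟩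
  rw [heq, Finset.card_biUnion]
  · have hrow : ∀ x ∈ Finset.Icc 1 L, ((Finset.Icc x L).image fun y => (x, y)).card = L + 1 - x := by
      intro x hx
      rw [Finset.card_image_of_injective _ (fun y y' h => by simpa using h), Nat.card_Icc]
    rw [Finset.sum_congr rfl hrow, two_mul_sum_Icc_sub L, hL]
    rcases Nat.lt_or_ge A 1 with h0 | h0
    · have : A = 0 := by omega
      subst this; rfl
    · have : 3 * A - 2 + 1 = 3 * A - 1 := by omega
      rw [this]
  · intro x _ x' _ hne
    simp only [Function.onFun]
    rw [Finset.disjoint_left]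
    intro t ht ht'
    obtain ⟨y, -, rfl⟩ := Finset.mem_image.1 ht
    obtain ⟨y', -, h⟩ := Finset.mem_image.1 ht'
    simp only [Prod.mk.injEq] at h
    exact hne h.1.symm


/-! ### The five admissible sets of transverse 4-tuples and their cardinalities -/

/-- `u₁ + u₂ + u₃ + u₄` as the frozen partial sum. [cite: MadrasSlade1993, Definition 1.2.4] -/
theorem psum4_four (d : ℕ) (u : Steps d) :
    psum4 d u 4 = twoStepV d u.1 + twoStepV d u.2.1 + twoStepV d u.2.2.1 + twoStepV d u.2.2.2 := rfl

/-- All four blocks realized: the admissible tuples are the four-step self-avoiding words `fiveStepIndex`.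
[cite: MadrasSlade1993, §1.2] -/
theorem filter_all_eq_fiveStepIndex (d : ℕ) :
    (Finset.univ.filter fun u : Steps d => u.2.1 ≠ revIdx u.1 ∧ u.2.2.1 ≠ revIdx u.2.1 ∧ u.2.2.2 ≠ revIdx u.2.2.1 ∧ psum4 d u 4 ≠ 0) =
      fiveStepIndex d := by
  ext ⟨a, b, c, e⟩
  simp only [Finset.mem_filter, Finset.mem_univ, true_and, fiveStepIndex, psum4_four]
  constructor
  · rintro ⟨h1, h2, h3, h4⟩
    refine ⟨h1, h2, h3, fun ⟨hc, he⟩ => h4 ?_⟩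
    rw [hc, he, revIdx, revIdx, twoStepV_not, twoStepV_not]; abel
  · rintro ⟨h1, h2, h3, h4⟩
    exact ⟨h1, h2, h3, fun h0 => h4 (eq_revIdx_of_sum_four_eq_zero d h1 h2 h0)⟩

/-- Block `u₁ + u₂` free (`β`-type): the admissible tuples. [cite: MadrasSlade1993, §1.2] -/
def betaOne (d : ℕ) : Finset (Steps d) :=
  Finset.univ.filter fun u => u.2.2.1 ≠ revIdx u.2.1 ∧ u.2.2.2 ≠ revIdx u.2.2.1 ∧ psum4 d u 4 ≠ 0

/-- Block `u₃ + u₄` free (`β`-type, mirror): the admissible tuples. [cite: MadrasSlade1993, §1.2] -/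
def betaTwo (d : ℕ) : Finset (Steps d) :=
  Finset.univ.filter fun u => u.2.1 ≠ revIdx u.1 ∧ u.2.2.1 ≠ revIdx u.2.1 ∧ psum4 d u 4 ≠ 0

/-- Block `u₂ + u₃` free (`γ`-type): the admissible tuples. [cite: MadrasSlade1993, §1.2] -/
def gammaSet (d : ℕ) : Finset (Steps d) :=
  Finset.univ.filter fun u => u.2.1 ≠ revIdx u.1 ∧ u.2.2.2 ≠ revIdx u.2.2.1 ∧ psum4 d u 4 ≠ 0

/-- `#(Fin d × Bool) = 2d`. [cite: MadrasSlade1993, §1.2] -/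
private theorem card_idx (d : ℕ) : Fintype.card (Fin d × Bool) = 2 * d := by
  rw [Fintype.card_prod, Fintype.card_fin, Fintype.card_bool, mul_comm]

/-- `#betaTwo = 2d·2d(2d−1)² − 2d(2d−2)` (non-reversing `(u₁,u₂,u₃)` times a free `u₄`, minus the unit squares). [cite: MadrasSlade1993, §1.2] -/
theorem card_betaTwo (d : ℕ) : (betaTwo d).card = 2 * d * (2 * d * (2 * d - 1) ^ 2) - 2 * d * (2 * d - 2) := by
  classical
  -- the big set: `(u₁,u₂,u₃)` non-reversing, `u₄` free
  set big : Finset (Steps d) := Finset.univ.filter fun u => u.2.1 ≠ revIdx u.1 ∧ u.2.2.1 ≠ revIdx u.2.1 with hbig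
  have hbig_eq : big = (fourStepIndex d).biUnion fun t => Finset.univ.image fun e : Fin d × Bool => (t.1, t.2.1, t.2.2, e) := by
    ext ⟨a, b, c, e⟩
    simp only [hbig, fourStepIndex, Finset.mem_filter, Finset.mem_univ, true_and, Finset.mem_biUnion, Finset.mem_image, Prod.mk.injEq]
    constructor
    · rintro ⟨h1, h2⟩; exact ⟨(a, b, c), ⟨h1, h2⟩, e, rfl, rfl, rfl, rfl⟩
    · rintro ⟨t, ⟨h1, h2⟩, e', rfl, rfl, rfl, rfl⟩; exact ⟨h1, h2⟩
  have hbig_card : big.card = 2 * d * (2 * d * (2 * d - 1) ^ 2) := by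
    rw [hbig_eq, Finset.card_biUnion]
    · have : ∀ t ∈ fourStepIndex d, (Finset.univ.image fun e : Fin d × Bool => (t.1, t.2.1, t.2.2, e)).card = 2 * d := by
        intro t _
        rw [Finset.card_image_of_injective _ (fun e e' h => by simpa using h), Finset.card_univ, card_idx]
      rw [Finset.sum_congr rfl this, Finset.sum_const, card_fourStepIndex, smul_eq_mul]; ring
    · intro t _ t' _ htt'
      simp only [Function.onFun]
      rw [Finset.disjoint_left]
      intro x hx hx'
      obtain ⟨e, -, rfl⟩ := Finset.mem_image.1 hx
      obtain ⟨e', -, h⟩ := Finset.mem_image.1 hx'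
      simp only [Prod.mk.injEq] at h
      obtain ⟨h1, h2, h3, -⟩ := h
      exact htt' (Prod.ext h1.symm (Prod.ext h2.symm h3.symm))
  -- the zero-sum part is `squareFour`
  have hsub : squareFour d ⊆ big := by
    intro u hu
    have hu' := squareFour_subset_nonrevFour d hu
    simp only [nonrevFour, Finset.mem_filter, Finset.mem_univ, true_and] at hu'
    exact Finset.mem_filter.2 ⟨Finset.mem_univ _, hu'.1, hu'.2.1⟩
  have heq : betaTwo d = big \ squareFour d := by
    ext ⟨a, b, c, e⟩
    simp only [betaTwo, hbig, squareFour, Finset.mem_filter, Finset.mem_univ, true_and, Finset.mem_sdiff, not_and, psum4_four]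
    constructor
    · rintro ⟨h1, h2, h4⟩
      refine ⟨⟨h1, h2⟩, fun _ _ hc he => h4 ?_⟩
      rw [hc, he, revIdx, revIdx, twoStepV_not, twoStepV_not]; abel
    · rintro ⟨⟨h1, h2⟩, h4⟩
      refine ⟨h1, h2, fun h0 => ?_⟩
      obtain ⟨hc, he⟩ := eq_revIdx_of_sum_four_eq_zero d h1 h2 h0
      exact h4 h1 (fun hba => h2 (by rw [hc, hba])) hc he
  rw [heq, Finset.card_sdiff_of_subset hsub, hbig_card, card_squareFour]

/-- `#betaOne = 2d·2d(2d−1)² − 2d(2d−2)` (a free `u₁` times non-reversing `(u₂,u₃,u₄)`, minus the rotated unit squares).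
[cite: MadrasSlade1993, §1.2] -/
theorem card_betaOne (d : ℕ) : (betaOne d).card = 2 * d * (2 * d * (2 * d - 1) ^ 2) - 2 * d * (2 * d - 2) := by
  classical
  set big : Finset (Steps d) := Finset.univ.filter fun u => u.2.2.1 ≠ revIdx u.2.1 ∧ u.2.2.2 ≠ revIdx u.2.2.1 with hbig
  have hbig_eq : big = (fourStepIndex d).biUnion fun t => Finset.univ.image fun a : Fin d × Bool => (a, t.1, t.2.1, t.2.2) := by
    ext ⟨a, b, c, e⟩
    simp only [hbig, fourStepIndex, Finset.mem_filter, Finset.mem_univ, true_and, Finset.mem_biUnion, Finset.mem_image, Prod.mk.injEq]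
    constructor
    · rintro ⟨h1, h2⟩; exact ⟨(b, c, e), ⟨h1, h2⟩, a, rfl, rfl, rfl, rfl⟩
    · rintro ⟨t, ⟨h1, h2⟩, a', rfl, rfl, rfl, rfl⟩; exact ⟨h1, h2⟩
  have hbig_card : big.card = 2 * d * (2 * d * (2 * d - 1) ^ 2) := by
    rw [hbig_eq, Finset.card_biUnion]
    · have : ∀ t ∈ fourStepIndex d, (Finset.univ.image fun a : Fin d × Bool => (a, t.1, t.2.1, t.2.2)).card = 2 * d := by
        intro t _
        rw [Finset.card_image_of_injective _ (fun a a' h => by simpa using h), Finset.card_univ, card_idx]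
      rw [Finset.sum_congr rfl this, Finset.sum_const, card_fourStepIndex, smul_eq_mul]; ring
    · intro t _ t' _ htt'
      simp only [Function.onFun]
      rw [Finset.disjoint_left]
      intro x hx hx'
      obtain ⟨a, -, rfl⟩ := Finset.mem_image.1 hx
      obtain ⟨a', -, h⟩ := Finset.mem_image.1 hx'
      simp only [Prod.mk.injEq] at h
      obtain ⟨-, h1, h2, h3⟩ := h
      exact htt' (Prod.ext h1.symm (Prod.ext h2.symm h3.symm))
  -- zero-sum part: `(−c, b, c, −b)` with `c ≠ ±b`
  set Z : Finset (Steps d) := Finset.univ.filter fun u =>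
    u.2.2.1 ≠ revIdx u.2.1 ∧ u.2.2.1 ≠ u.2.1 ∧ u.1 = revIdx u.2.2.1 ∧ u.2.2.2 = revIdx u.2.1 with hZ
  have hZ_eq : Z = (Finset.univ : Finset (Fin d × Bool)).biUnion fun b =>
      (Finset.univ.filter fun c : Fin d × Bool => c ≠ revIdx b ∧ c ≠ b).image fun c => (revIdx c, b, c, revIdx b) := by
    ext ⟨a, b, c, e⟩
    simp only [hZ, Finset.mem_filter, Finset.mem_univ, true_and, Finset.mem_biUnion, Finset.mem_image, Prod.mk.injEq]
    constructor
    · rintro ⟨h1, h2, h3, h4⟩; exact ⟨b, c, ⟨h1, h2⟩, h3.symm, rfl, rfl, h4.symm⟩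
    · rintro ⟨b', c', ⟨h1, h2⟩, h3, rfl, rfl, h4⟩; exact ⟨h1, h2, h3.symm, h4.symm⟩
  have hZ_card : Z.card = 2 * d * (2 * d - 2) := by
    rw [hZ_eq, Finset.card_biUnion]
    · have : ∀ b ∈ (Finset.univ : Finset (Fin d × Bool)), ((Finset.univ.filter fun c : Fin d × Bool => c ≠ revIdx b ∧ c ≠ b).image
          fun c => (revIdx c, b, c, revIdx b)).card = 2 * d - 2 := by
        intro b _
        rw [Finset.card_image_of_injective _ (fun c c' h => by simp only [Prod.mk.injEq] at h; exact h.2.2.1),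
          card_filter_ne_ne_idx d (revIdx_ne_self b)]
      rw [Finset.sum_congr rfl this, Finset.sum_const, Finset.card_univ, card_idx, smul_eq_mul]
    · intro b _ b' _ hbb'
      simp only [Function.onFun]
      rw [Finset.disjoint_left]
      intro x hx hx'
      obtain ⟨c, -, rfl⟩ := Finset.mem_image.1 hx
      obtain ⟨c', -, h⟩ := Finset.mem_image.1 hx'
      simp only [Prod.mk.injEq] at h
      exact hbb' h.2.1.symm
  have hsub : Z ⊆ big := by
    rintro ⟨a, b, c, e⟩ hu
    simp only [hZ, hbig, Finset.mem_filter, Finset.mem_univ, true_and] at hu ⊢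
    obtain ⟨h1, h2, -, h4⟩ := hu
    exact ⟨h1, fun h => h2 (revIdx_inj (by rw [← h]; exact h4))⟩
  have heq : betaOne d = big \ Z := by
    ext ⟨a, b, c, e⟩
    simp only [betaOne, hbig, hZ, Finset.mem_filter, Finset.mem_univ, true_and, Finset.mem_sdiff, not_and, psum4_four]
    constructor
    · rintro ⟨h1, h2, h4⟩
      refine ⟨⟨h1, h2⟩, fun _ _ ha he => h4 ?_⟩
      rw [ha, he, revIdx, revIdx, twoStepV_not, twoStepV_not]; abel
    · rintro ⟨⟨h1, h2⟩, h4⟩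
      refine ⟨h1, h2, fun h0 => ?_⟩
      -- rotate: `b + c + e + a = 0` with `(b,c)`, `(c,e)` non-reversing ⇒ `e = −b`, `a = −c`
      have h0' : twoStepV d b + twoStepV d c + twoStepV d e + twoStepV d a = 0 := by rw [← h0]; abel
      obtain ⟨he, ha⟩ := eq_revIdx_of_sum_four_eq_zero d h1 h2 h0'
      exact h4 h1 (fun hcb => h2 (by rw [he, hcb])) ha he
  rw [heq, Finset.card_sdiff_of_subset hsub, hbig_card, hZ_card]


/-- `#gammaSet = (2d(2d−1))² − 2d(2d−1) − 2d(2d−2)` (two independent non-reversing pairs, minus the «folded» words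
`(a, b, −b, −a)` and the unit squares). [cite: MadrasSlade1993, §1.2] -/
theorem card_gammaSet (d : ℕ) :
    (gammaSet d).card = (2 * d * (2 * d - 1)) * (2 * d * (2 * d - 1)) - (2 * d * (2 * d - 1) + 2 * d * (2 * d - 2)) := by
  classical
  set big : Finset (Steps d) := Finset.univ.filter fun u => u.2.1 ≠ revIdx u.1 ∧ u.2.2.2 ≠ revIdx u.2.2.1 with hbig
  have hbig_eq : big = (threeStepIndex d ×ˢ threeStepIndex d).image fun p => (p.1.1, p.1.2, p.2.1, p.2.2) := by
    ext ⟨a, b, c, e⟩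
    simp only [hbig, threeStepIndex, Finset.mem_filter, Finset.mem_univ, true_and, Finset.mem_image, Finset.mem_product,
      Prod.mk.injEq, revIdx]
    constructor
    · rintro ⟨h1, h2⟩; exact ⟨((a, b), (c, e)), ⟨h1, h2⟩, rfl, rfl, rfl, rfl⟩
    · rintro ⟨p, ⟨h1, h2⟩, rfl, rfl, rfl, rfl⟩; exact ⟨h1, h2⟩
  have hbig_card : big.card = (2 * d * (2 * d - 1)) * (2 * d * (2 * d - 1)) := by
    rw [hbig_eq, Finset.card_image_of_injective _ (fun p q h => by
      obtain ⟨⟨a, b⟩, ⟨c, e⟩⟩ := p; obtain ⟨⟨a', b'⟩, ⟨c', e'⟩⟩ := q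
      simp only [Prod.mk.injEq] at h ⊢; tauto), Finset.card_product, card_threeStepIndex]
  -- the folded words `(a, b, −b, −a)`, `b ≠ −a`
  set Z1 : Finset (Steps d) := Finset.univ.filter fun u => u.2.1 ≠ revIdx u.1 ∧ u.2.2.1 = revIdx u.2.1 ∧ u.2.2.2 = revIdx u.1 with hZ1
  have hZ1_eq : Z1 = (threeStepIndex d).image fun p => (p.1, p.2, revIdx p.2, revIdx p.1) := by
    ext ⟨a, b, c, e⟩
    simp only [hZ1, threeStepIndex, Finset.mem_filter, Finset.mem_univ, true_and, Finset.mem_image, Prod.mk.injEq, revIdx]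
    constructor
    · rintro ⟨h1, h2, h3⟩; exact ⟨(a, b), h1, rfl, rfl, h2.symm, h3.symm⟩
    · rintro ⟨p, h1, rfl, rfl, h2, h3⟩; exact ⟨h1, h2.symm, h3.symm⟩
  have hZ1_card : Z1.card = 2 * d * (2 * d - 1) := by
    rw [hZ1_eq, Finset.card_image_of_injective _ (fun p q h => by
      obtain ⟨a, b⟩ := p; obtain ⟨a', b'⟩ := q
      simp only [Prod.mk.injEq] at h ⊢; exact ⟨h.1, h.2.1⟩), card_threeStepIndex]
  have hdisj : Disjoint Z1 (squareFour d) := by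
    rw [Finset.disjoint_left]
    rintro ⟨a, b, c, e⟩ h1 h2
    simp only [hZ1, squareFour, Finset.mem_filter, Finset.mem_univ, true_and] at h1 h2
    obtain ⟨-, hc, -⟩ := h1
    obtain ⟨-, hba, hc', -⟩ := h2
    exact hba (revIdx_inj (hc.symm.trans hc'))
  have hsub : Z1 ∪ squareFour d ⊆ big := by
    rintro ⟨a, b, c, e⟩ hu
    simp only [Finset.mem_union, hZ1, squareFour, hbig, Finset.mem_filter, Finset.mem_univ, true_and] at hu ⊢
    rcases hu with ⟨h1, hc, he⟩ | ⟨h1, hba, hc, he⟩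
    · refine ⟨h1, fun h => h1 ?_⟩
      rw [he, hc, revIdx_revIdx] at h
      exact h.symm
    · refine ⟨h1, fun h => h1 ?_⟩
      rw [he, hc, revIdx_revIdx] at h
      rw [← h, revIdx_revIdx]
  have heq : gammaSet d = big \ (Z1 ∪ squareFour d) := by
    ext ⟨a, b, c, e⟩
    simp only [gammaSet, hbig, hZ1, squareFour, Finset.mem_filter, Finset.mem_univ, true_and, Finset.mem_sdiff, Finset.mem_union,
      not_or, not_and, psum4_four]
    constructor
    · rintro ⟨h1, h2, h4⟩
      refine ⟨⟨h1, h2⟩, fun _ hc he => h4 ?_, fun _ _ hc he => h4 ?_⟩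
      · rw [hc, he, revIdx, revIdx, twoStepV_not, twoStepV_not]; abel
      · rw [hc, he, revIdx, revIdx, twoStepV_not, twoStepV_not]; abel
    · rintro ⟨⟨h1, h2⟩, hz1, hz2⟩
      refine ⟨h1, h2, fun h0 => ?_⟩
      by_cases hcb : c = revIdx b
      · -- folded: then `a + e = 0`
        have hae : twoStepV d a + twoStepV d e = 0 := by
          have : twoStepV d a + twoStepV d b + twoStepV d c + twoStepV d e =
              (twoStepV d a + twoStepV d e) + (twoStepV d b + twoStepV d c) := by abel
          rw [this, hcb, revIdx, twoStepV_not, add_neg_cancel, add_zero] at h0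
          exact h0
        exact hz1 h1 hcb (twoStepV_add_eq_zero d hae)
      · obtain ⟨hc, he⟩ := eq_revIdx_of_sum_four_eq_zero d h1 hcb h0
        exact hz2 h1 (fun hba => hcb (by rw [hc, hba])) hc he
  rw [heq, Finset.card_sdiff_of_subset hsub, hbig_card, Finset.card_union_of_disjoint hdisj, hZ1_card, card_squareFour]


/-! ### The fibre of a regime-(i) word by its realized blocks -/

section fibres

variable {d A L : ℕ} {R : ℕ → ℕ} {f : ℕ × ℕ × ℕ × ℕ}

open Classical in
/-- All four blocks realized: fibre `α = #fiveStepIndex`. [cite: MadrasSlade1993, §1.2] -/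
theorem card_filter_good_all (h0 : Occ2 R L f 0) (h1 : Occ2 R L f 1) (h2 : Occ2 R L f 2) (h4 : Occ4 R L f) :
    (Finset.univ.filter (Good d R L f)).card = 2 * d * (2 * d - 1) ^ 3 - 2 * d * (2 * d - 2) := by
  classical
  rw [← card_fiveStepIndex, ← filter_all_eq_fiveStepIndex]
  congr 1
  refine Finset.filter_congr fun u _ => ?_
  simp only [Good]
  exact ⟨fun ⟨g0, g1, g2, g4⟩ => ⟨g0 h0, g1 h1, g2 h2, g4 h4⟩, fun ⟨g0, g1, g2, g4⟩ => ⟨fun _ => g0, fun _ => g1, fun _ => g2, fun _ => g4⟩⟩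

open Classical in
/-- Block `u₁+⋯+u₄` not realized: fibre `κ = #nonrevFour`. [cite: MadrasSlade1993, §1.2] -/
theorem card_filter_good_K (h0 : Occ2 R L f 0) (h1 : Occ2 R L f 1) (h2 : Occ2 R L f 2) (h4 : ¬ Occ4 R L f) :
    (Finset.univ.filter (Good d R L f)).card = 2 * d * (2 * d - 1) ^ 3 := by
  classical
  rw [← card_nonrevFour]
  congr 1
  refine Finset.filter_congr fun u _ => ?_
  simp only [Good]
  exact ⟨fun ⟨g0, g1, g2, _⟩ => ⟨g0 h0, g1 h1, g2 h2⟩, fun ⟨g0, g1, g2⟩ => ⟨fun _ => g0, fun _ => g1, fun _ => g2, fun h => absurd h h4⟩⟩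

open Classical in
/-- Block `u₁+u₂` not realized: fibre `β = #betaOne`. [cite: MadrasSlade1993, §1.2] -/
theorem card_filter_good_B1 (h0 : ¬ Occ2 R L f 0) (h1 : Occ2 R L f 1) (h2 : Occ2 R L f 2) (h4 : Occ4 R L f) :
    (Finset.univ.filter (Good d R L f)).card = 2 * d * (2 * d * (2 * d - 1) ^ 2) - 2 * d * (2 * d - 2) := by
  classical
  rw [← card_betaOne]
  congr 1
  refine Finset.filter_congr fun u _ => ?_
  simp only [Good]
  exact ⟨fun ⟨_, g1, g2, g4⟩ => ⟨g1 h1, g2 h2, g4 h4⟩, fun ⟨g1, g2, g4⟩ => ⟨fun h => absurd h h0, fun _ => g1, fun _ => g2, fun _ => g4⟩⟩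

open Classical in
/-- Block `u₃+u₄` not realized: fibre `β = #betaTwo`. [cite: MadrasSlade1993, §1.2] -/
theorem card_filter_good_B2 (h0 : Occ2 R L f 0) (h1 : Occ2 R L f 1) (h2 : ¬ Occ2 R L f 2) (h4 : Occ4 R L f) :
    (Finset.univ.filter (Good d R L f)).card = 2 * d * (2 * d * (2 * d - 1) ^ 2) - 2 * d * (2 * d - 2) := by
  classical
  rw [← card_betaTwo]
  congr 1
  refine Finset.filter_congr fun u _ => ?_
  simp only [Good]
  exact ⟨fun ⟨g0, g1, _, g4⟩ => ⟨g0 h0, g1 h1, g4 h4⟩, fun ⟨g0, g1, g4⟩ => ⟨fun _ => g0, fun _ => g1, fun h => absurd h h2, fun _ => g4⟩⟩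

open Classical in
/-- Block `u₂+u₃` not realized: fibre `γ = #gammaSet`. [cite: MadrasSlade1993, §1.2] -/
theorem card_filter_good_G (h0 : Occ2 R L f 0) (h1 : ¬ Occ2 R L f 1) (h2 : Occ2 R L f 2) (h4 : Occ4 R L f) :
    (Finset.univ.filter (Good d R L f)).card = (2 * d * (2 * d - 1)) * (2 * d * (2 * d - 1)) - (2 * d * (2 * d - 1) + 2 * d * (2 * d - 2)) := by
  classical
  rw [← card_gammaSet]
  congr 1
  refine Finset.filter_congr fun u _ => ?_
  simp only [Good]
  exact ⟨fun ⟨g0, _, g2, g4⟩ => ⟨g0 h0, g2 h2, g4 h4⟩, fun ⟨g0, g2, g4⟩ => ⟨fun _ => g0, fun h => absurd h h1, fun _ => g2, fun _ => g4⟩⟩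

end fibres

open Classical in
/-- The fibre of a regime-(i) word as the filter of the block constraints. [cite: MadrasSlade1993, §4.2, remark after Theorem 4.2.4 (p. 94)] -/
theorem admS_eq_filter_good (d : ℕ) {A : ℕ} (hA : 2 ≤ A) {f : ℕ × ℕ × ℕ × ℕ} (hf : IsFlats (3 * A + 2) f)
    (hinj : SegInj (stapleR A) (3 * A - 2) f) :
    admS d A f = Finset.univ.filter (Good d (stapleR A) (3 * A - 2) f) := by
  classical
  ext u
  rw [mem_admS, Finset.mem_filter]
  simp only [Finset.mem_univ, true_and]
  exact mem_saws_iff_good hf (by omega) (isRedWord_stapleR hA) hinj u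

/-- Type κ of a free pair: the last free plateau at least `2A − 1` above the first, on the two ascents. [cite: MadrasSlade1993, §4.2, remark after Theorem 4.2.4 (p. 94)] -/
def FibK (A : ℕ) (t : ℕ × ℕ) : Prop := t.1 < A ∧ t.1 + 2 * A ≤ t.2 + 1

/-- Type β of a free pair. [cite: MadrasSlade1993, §4.2, remark after Theorem 4.2.4 (p. 94)] -/
def FibB (A : ℕ) (t : ℕ × ℕ) : Prop :=
  (t.1 < t.2 ∧ t.1 + t.2 < 2 * A) ∨ (A ≤ t.1 ∧ t.1 < 2 * A ∧ 4 * A < t.1 + t.2 + 2) ∨ (2 * A ≤ t.1 ∧ t.1 < t.2)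

/-- Type γ of a free pair. [cite: MadrasSlade1993, §4.2, remark after Theorem 4.2.4 (p. 94)] -/
def FibG (A : ℕ) (t : ℕ × ℕ) : Prop :=
  (t.1 < A ∧ A ≤ t.2 ∧ 2 * A < t.1 + t.2 ∧ t.2 + 2 < t.1 + 2 * A) ∨ (A ≤ t.1 ∧ t.1 < t.2 ∧ t.1 + t.2 + 2 < 4 * A)

/-- `FibK` is decidable. [cite: MadrasSlade1993, §4.2, remark after Theorem 4.2.4 (p. 94)] -/
instance (A : ℕ) : DecidablePred (FibK A) := fun t => by unfold FibK; infer_instance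

/-- `FibB` is decidable. [cite: MadrasSlade1993, §4.2, remark after Theorem 4.2.4 (p. 94)] -/
instance (A : ℕ) : DecidablePred (FibB A) := fun t => by unfold FibB; infer_instance

/-- `FibG` is decidable. [cite: MadrasSlade1993, §4.2, remark after Theorem 4.2.4 (p. 94)] -/
instance (A : ℕ) : DecidablePred (FibG A) := fun t => by unfold FibG; infer_instance

/-- The fibre value of a free pair by type (`κ, β, γ, α`). [cite: MadrasSlade1993, §4.2, remark after Theorem 4.2.4 (p. 94)] -/
def fibVal (d A : ℕ) (t : ℕ × ℕ) : ℕ :=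
  if FibK A t then 2 * d * (2 * d - 1) ^ 3
  else if FibB A t then 2 * d * (2 * d * (2 * d - 1) ^ 2) - 2 * d * (2 * d - 2)
  else if FibG A t then (2 * d * (2 * d - 1)) * (2 * d * (2 * d - 1)) - (2 * d * (2 * d - 1) + 2 * d * (2 * d - 2))
  else 2 * d * (2 * d - 1) ^ 3 - 2 * d * (2 * d - 2)

open Classical in
/-- ★ **The fibre of the regime-(i) word with free plateaus `(x, y)` is `fibVal d A (x, y)`** (the rule of FINDING (13c)).
[cite: MadrasSlade1993, §4.2, remark after Theorem 4.2.4 (p. 94)] -/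
theorem card_admS_phi (d : ℕ) {A x y : ℕ} (hA : 2 ≤ A) (ht : (x, y) ∈ freePairs A) :
    (admS d A (phi A (x, y))).card = fibVal d A (x, y) := by
  classical
  rw [mem_freePairs] at ht
  obtain ⟨hx1, hxy, hyL⟩ := ht
  have hmem := phi_mem hA (mem_freePairs.2 ⟨hx1, hxy, hyL⟩)
  have hfl := (mem_stapleFlats.1 hmem).1
  simp only [fibVal, FibK, FibB, FibG]
  by_cases c1 : y < A
  · have hphi : phi A (x, y) = (x, y + 1, A + 2, 2 * A + 2) := by simp only [phi]; rw [if_pos c1]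
    rw [hphi] at hfl ⊢
    obtain ⟨hinj, o0, o1, o2, o4⟩ := br1 hx1 hxy c1
    rw [admS_eq_filter_good d hA hfl hinj]
    by_cases cxy : x = y
    · rw [card_filter_good_all (o0.2 cxy) (o1.2 trivial) (o2.2 trivial) (o4.2 trivial),
        if_neg (by omega), if_neg (by omega), if_neg (by omega)]
    · rw [card_filter_good_B1 (fun h => cxy (o0.1 h)) (o1.2 trivial) (o2.2 trivial) (o4.2 trivial),
        if_neg (by omega), if_pos (by omega)]
  by_cases c2 : x < A
  · by_cases c3 : y < 2 * A
    · have hphi : phi A (x, y) = (x, A + 1, y + 2, 2 * A + 2) := by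
        simp only [phi]; rw [if_neg c1, if_pos c2, if_pos c3]
      rw [hphi] at hfl ⊢
      obtain ⟨hinj, o0, o1, o2, o4⟩ := br2 hx1 c2 (by omega) c3
      rw [admS_eq_filter_good d hA hfl hinj]
      rcases lt_trichotomy (x + y) (2 * A) with hlt | heq | hgt
      · rw [card_filter_good_B1 (fun h => by have := o0.1 h; omega) (o1.2 (by omega)) (o2.2 trivial) (o4.2 trivial),
          if_neg (by omega), if_pos (by omega)]
      · rw [card_filter_good_all (o0.2 (by omega)) (o1.2 (by omega)) (o2.2 trivial) (o4.2 trivial),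
          if_neg (by omega), if_neg (by omega), if_neg (by omega)]
      · rw [card_filter_good_G (o0.2 (by omega)) (fun h => by have := o1.1 h; omega) (o2.2 trivial) (o4.2 trivial),
          if_neg (by omega), if_neg (by omega), if_pos (by omega)]
    · have hphi : phi A (x, y) = (x, A + 1, 2 * A + 1, y + 3) := by
        simp only [phi]; rw [if_neg c1, if_pos c2, if_neg c3]
      rw [hphi] at hfl ⊢
      obtain ⟨hinj, o0, o1, o2, o4⟩ := br3 hx1 c2 (by omega) hyL
      rw [admS_eq_filter_good d hA hfl hinj]
      rcases lt_trichotomy (y + 2) (x + 2 * A) with hlt | heq | hgt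
      · rw [card_filter_good_G (o0.2 trivial) (fun h => by have := o1.1 h; omega) (o2.2 trivial) (o4.2 (by omega)),
          if_neg (by omega), if_neg (by omega), if_pos (by omega)]
      · rw [card_filter_good_all (o0.2 trivial) (o1.2 (by omega)) (o2.2 trivial) (o4.2 (by omega)),
          if_neg (by omega), if_neg (by omega), if_neg (by omega)]
      · rw [card_filter_good_K (o0.2 trivial) (o1.2 (by omega)) (o2.2 trivial) (fun h => by have := o4.1 h; omega),
          if_pos (by omega)]
  by_cases c3 : y < 2 * A
  · have hphi : phi A (x, y) = (A, x + 1, y + 2, 2 * A + 2) := by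
      simp only [phi]; rw [if_neg c1, if_neg c2, if_pos c3]
    rw [hphi] at hfl ⊢
    obtain ⟨hinj, o0, o1, o2, o4⟩ := br4 (by omega) hxy c3 hA
    rw [admS_eq_filter_good d hA hfl hinj]
    by_cases cxy : x = y
    · rw [card_filter_good_all (o0.2 trivial) (o1.2 cxy) (o2.2 trivial) (o4.2 trivial),
        if_neg (by omega), if_neg (by omega), if_neg (by omega)]
    · rw [card_filter_good_G (o0.2 trivial) (fun h => cxy (o1.1 h)) (o2.2 trivial) (o4.2 trivial),
        if_neg (by omega), if_neg (by omega), if_pos (by omega)]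
  by_cases c4 : x < 2 * A
  · have hphi : phi A (x, y) = (A, x + 1, 2 * A + 1, y + 3) := by
      simp only [phi]; rw [if_neg c1, if_neg c2, if_neg c3, if_pos c4]
    rw [hphi] at hfl ⊢
    obtain ⟨hinj, o0, o1, o2, o4⟩ := br5 (by omega) c4 (by omega) hyL hA
    rw [admS_eq_filter_good d hA hfl hinj]
    rcases lt_trichotomy (x + y + 2) (4 * A) with hlt | heq | hgt
    · rw [card_filter_good_G (o0.2 trivial) (fun h => by have := o1.1 h; omega) (o2.2 (by omega)) (o4.2 trivial),
        if_neg (by omega), if_neg (by omega), if_pos (by omega)]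
    · rw [card_filter_good_all (o0.2 trivial) (o1.2 (by omega)) (o2.2 (by omega)) (o4.2 trivial),
        if_neg (by omega), if_neg (by omega), if_neg (by omega)]
    · rw [card_filter_good_B2 (o0.2 trivial) (o1.2 (by omega)) (fun h => by have := o2.1 h; omega) (o4.2 trivial),
        if_neg (by omega), if_pos (by omega)]
  · have hphi : phi A (x, y) = (A, 2 * A, x + 2, y + 3) := by
      simp only [phi]; rw [if_neg c1, if_neg c2, if_neg c3, if_neg c4]
    rw [hphi] at hfl ⊢
    obtain ⟨hinj, o0, o1, o2, o4⟩ := br6 (by omega) hxy hyL hA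
    rw [admS_eq_filter_good d hA hfl hinj]
    by_cases cxy : x = y
    · rw [card_filter_good_all (o0.2 trivial) (o1.2 trivial) (o2.2 cxy) (o4.2 trivial),
        if_neg (by omega), if_neg (by omega), if_neg (by omega)]
    · rw [card_filter_good_B2 (o0.2 trivial) (o1.2 trivial) (fun h => cxy (o2.1 h)) (o4.2 trivial),
        if_neg (by omega), if_pos (by omega)]


/-! ### Counting the free pairs of each type (rows of lattice points) -/

/-- A family of rows `{(X j, y) : lo j ≤ y ≤ hi j}`, `j < n`. [cite: MadrasSlade1993, §4.2, remark after Theorem 4.2.4 (p. 94)] -/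
def rows (n : ℕ) (X lo hi : ℕ → ℕ) : Finset (ℕ × ℕ) :=
  (Finset.range n).biUnion fun j => (Finset.Icc (lo j) (hi j)).image fun y => (X j, y)

/-- Membership in `rows`. [cite: MadrasSlade1993, §4.2, remark after Theorem 4.2.4 (p. 94)] -/
theorem mem_rows {n : ℕ} {X lo hi : ℕ → ℕ} {x y : ℕ} :
    (x, y) ∈ rows n X lo hi ↔ ∃ j, j < n ∧ x = X j ∧ lo j ≤ y ∧ y ≤ hi j := by
  simp only [rows, Finset.mem_biUnion, Finset.mem_range, Finset.mem_image, Finset.mem_Icc, Prod.mk.injEq]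
  constructor
  · rintro ⟨j, hj, y', ⟨h1, h2⟩, h3, rfl⟩; exact ⟨j, hj, h3.symm, h1, h2⟩
  · rintro ⟨j, hj, rfl, h1, h2⟩; exact ⟨j, hj, y, ⟨h1, h2⟩, rfl, rfl⟩

/-- The number of points of a family of rows with distinct abscissae. [cite: MadrasSlade1993, §4.2, remark after Theorem 4.2.4 (p. 94)] -/
theorem card_rows {n : ℕ} {X lo hi : ℕ → ℕ} (hX : ∀ i j, i < n → j < n → X i = X j → i = j) :
    (rows n X lo hi).card = ∑ j ∈ Finset.range n, (hi j + 1 - lo j) := by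
  rw [rows, Finset.card_biUnion]
  · refine Finset.sum_congr rfl fun j _ => ?_
    rw [Finset.card_image_of_injective _ (fun y y' h => by simpa using h), Nat.card_Icc]
  · intro i hi j hj hne
    simp only [Function.onFun]
    rw [Finset.disjoint_left]
    intro t ht ht'
    obtain ⟨y, -, rfl⟩ := Finset.mem_image.1 ht
    obtain ⟨y', -, h⟩ := Finset.mem_image.1 ht'
    simp only [Prod.mk.injEq] at h
    exact hne (hX i j (Finset.mem_coe.1 hi |> Finset.mem_range.1) (Finset.mem_coe.1 hj |> Finset.mem_range.1) h.1.symm)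

/-- `Σ_{j<n} (2j + 1) = n²`. [cite: MadrasSlade1993, §4.2, remark after Theorem 4.2.4 (p. 94)] -/
theorem sum_range_odd (n : ℕ) : ∑ j ∈ Finset.range n, (2 * j + 1) = n * n := by
  induction n with
  | zero => simp
  | succ n ih => rw [Finset.sum_range_succ, ih]; ring

/-- `2 Σ_{j<n} (j + 1) = n (n + 1)`. [cite: MadrasSlade1993, §4.2, remark after Theorem 4.2.4 (p. 94)] -/
theorem two_mul_sum_range_succ (n : ℕ) : 2 * ∑ j ∈ Finset.range n, (j + 1) = n * (n + 1) := by
  induction n with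
  | zero => simp
  | succ n ih => rw [Finset.sum_range_succ, mul_add, ih]; ring

/-- `2 Σ_{j<n} (n − j) = n (n + 1)`. [cite: MadrasSlade1993, §4.2, remark after Theorem 4.2.4 (p. 94)] -/
theorem two_mul_sum_range_rev (n : ℕ) : 2 * ∑ j ∈ Finset.range n, (n - j) = n * (n + 1) := by
  have : ∑ j ∈ Finset.range n, (n - j) = ∑ j ∈ Finset.range n, (j + 1) := by
    rw [← Finset.sum_range_reflect]
    refine Finset.sum_congr rfl fun j hj => ?_
    have := Finset.mem_range.1 hj; omega
  rw [this, two_mul_sum_range_succ]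

/-- Type κ: `2 · #K = A (A − 1)`. [cite: MadrasSlade1993, §4.2, remark after Theorem 4.2.4 (p. 94)] -/
theorem two_mul_card_filter_fibK {A : ℕ} (hA : 2 ≤ A) : 2 * ((freePairs A).filter (FibK A)).card = A * (A - 1) := by
  have heq : (freePairs A).filter (FibK A) = rows (A - 1) (fun j => A - 1 - j) (fun j => 3 * A - 2 - j) (fun _ => 3 * A - 2) := by
    ext ⟨x, y⟩
    rw [Finset.mem_filter, mem_freePairs, mem_rows]
    simp only [FibK]
    constructor
    · rintro ⟨⟨h1, h2, h3⟩, h4, h5⟩; exact ⟨A - 1 - x, by omega, by omega, by omega, by omega⟩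
    · rintro ⟨j, hj, hx, h1, h2⟩; omega
  rw [heq, card_rows (fun i j hi hj h => by omega)]
  have : ∑ j ∈ Finset.range (A - 1), (3 * A - 2 + 1 - (3 * A - 2 - j)) = ∑ j ∈ Finset.range (A - 1), (j + 1) :=
    Finset.sum_congr rfl fun j hj => by have := Finset.mem_range.1 hj; omega
  rw [this, two_mul_sum_range_succ]
  have h1 : A - 1 + 1 = A := by omega
  rw [h1]; ring

/-- Type β: `#B = 2 (A − 1)²` (three row families). [cite: MadrasSlade1993, §4.2, remark after Theorem 4.2.4 (p. 94)] -/
theorem card_filter_fibB {A : ℕ} (hA : 2 ≤ A) : 2 * ((freePairs A).filter (FibB A)).card = 4 * ((A - 1) * (A - 1)) := by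
  set R1 := rows (A - 1) (fun j => A - 1 - j) (fun j => A - j) (fun j => A + j) with hR1
  set R2 := rows A (fun j => A + j) (fun j => 3 * A - 1 - j) (fun _ => 3 * A - 2) with hR2
  set R3 := rows (A - 2) (fun j => 2 * A + j) (fun j => 2 * A + 1 + j) (fun _ => 3 * A - 2) with hR3
  have heq : (freePairs A).filter (FibB A) = R1 ∪ R2 ∪ R3 := by
    ext ⟨x, y⟩
    rw [Finset.mem_filter, mem_freePairs, Finset.mem_union, Finset.mem_union, hR1, hR2, hR3, mem_rows, mem_rows, mem_rows]
    simp only [FibB]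
    constructor
    · rintro ⟨⟨h1, h2, h3⟩, hb | hb | hb⟩
      · exact Or.inl (Or.inl ⟨A - 1 - x, by omega, by omega, by omega, by omega⟩)
      · exact Or.inl (Or.inr ⟨x - A, by omega, by omega, by omega, by omega⟩)
      · exact Or.inr ⟨x - 2 * A, by omega, by omega, by omega, by omega⟩
    · rintro ((⟨j, hj, hx, h1, h2⟩ | ⟨j, hj, hx, h1, h2⟩) | ⟨j, hj, hx, h1, h2⟩) <;> omega
  have hd12 : Disjoint R1 R2 := by
    rw [Finset.disjoint_left]; rintro ⟨x, y⟩ h1 h2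
    rw [hR1, mem_rows] at h1; rw [hR2, mem_rows] at h2
    obtain ⟨j, hj, hx, -, -⟩ := h1; obtain ⟨j', hj', hx', -, -⟩ := h2; omega
  have hd3 : Disjoint (R1 ∪ R2) R3 := by
    rw [Finset.disjoint_left]; rintro ⟨x, y⟩ h12 h3
    rw [hR3, mem_rows] at h3
    obtain ⟨j', hj', hx', -, -⟩ := h3
    rcases Finset.mem_union.1 h12 with h1 | h2
    · rw [hR1, mem_rows] at h1; obtain ⟨j, hj, hx, -, -⟩ := h1; omega
    · rw [hR2, mem_rows] at h2; obtain ⟨j, hj, hx, h, -⟩ := h2; omega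
  rw [heq, Finset.card_union_of_disjoint hd3, Finset.card_union_of_disjoint hd12, hR1, hR2, hR3,
    card_rows (fun i j hi hj h => by omega), card_rows (fun i j hi hj h => by omega), card_rows (fun i j hi hj h => by omega)]
  have e1 : ∑ j ∈ Finset.range (A - 1), (A + j + 1 - (A - j)) = ∑ j ∈ Finset.range (A - 1), (2 * j + 1) :=
    Finset.sum_congr rfl fun j hj => by have := Finset.mem_range.1 hj; omega
  have e2 : ∑ j ∈ Finset.range A, (3 * A - 2 + 1 - (3 * A - 1 - j)) = ∑ j ∈ Finset.range A, j :=
    Finset.sum_congr rfl fun j hj => by have := Finset.mem_range.1 hj; omega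
  have e3 : ∑ j ∈ Finset.range (A - 2), (3 * A - 2 + 1 - (2 * A + 1 + j)) = ∑ j ∈ Finset.range (A - 2), (A - 2 - j) :=
    Finset.sum_congr rfl fun j hj => by have := Finset.mem_range.1 hj; omega
  rw [e1, e2, e3, sum_range_odd]
  have g2 : (∑ j ∈ Finset.range A, j) * 2 = A * (A - 1) := Finset.sum_range_id_mul_two A
  have g3 : 2 * ∑ j ∈ Finset.range (A - 2), (A - 2 - j) = (A - 2) * (A - 2 + 1) := two_mul_sum_range_rev (A - 2)
  obtain ⟨B, rfl⟩ : ∃ B, A = B + 2 := ⟨A - 2, by omega⟩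
  simp only [Nat.add_sub_cancel] at g3 ⊢
  have : B + 2 - 1 = B + 1 := by omega
  rw [this] at g2 ⊢
  nlinarith [g2, g3]

/-- Type γ: `#G = (A − 2)² + (A − 1)²` (two row families). [cite: MadrasSlade1993, §4.2, remark after Theorem 4.2.4 (p. 94)] -/
theorem card_filter_fibG {A : ℕ} (hA : 2 ≤ A) :
    ((freePairs A).filter (FibG A)).card = (A - 2) * (A - 2) + (A - 1) * (A - 1) := by
  set R1 := rows (A - 2) (fun j => j + 2) (fun j => 2 * A - 1 - j) (fun j => 2 * A - 1 + j) with hR1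
  set R2 := rows (A - 1) (fun j => 2 * A - 2 - j) (fun j => 2 * A - 1 - j) (fun j => 2 * A - 1 + j) with hR2
  have heq : (freePairs A).filter (FibG A) = R1 ∪ R2 := by
    ext ⟨x, y⟩
    rw [Finset.mem_filter, mem_freePairs, Finset.mem_union, hR1, hR2, mem_rows, mem_rows]
    simp only [FibG]
    constructor
    · rintro ⟨⟨h1, h2, h3⟩, hb | hb⟩
      · exact Or.inl ⟨x - 2, by omega, by omega, by omega, by omega⟩
      · exact Or.inr ⟨2 * A - 2 - x, by omega, by omega, by omega, by omega⟩
    · rintro (⟨j, hj, hx, h1, h2⟩ | ⟨j, hj, hx, h1, h2⟩) <;> omega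
  have hd : Disjoint R1 R2 := by
    rw [Finset.disjoint_left]; rintro ⟨x, y⟩ h1 h2
    rw [hR1, mem_rows] at h1; rw [hR2, mem_rows] at h2
    obtain ⟨j, hj, hx, -, -⟩ := h1; obtain ⟨j', hj', hx', -, -⟩ := h2; omega
  rw [heq, Finset.card_union_of_disjoint hd, hR1, hR2, card_rows (fun i j hi hj h => by omega),
    card_rows (fun i j hi hj h => by omega)]
  have e1 : ∑ j ∈ Finset.range (A - 2), (2 * A - 1 + j + 1 - (2 * A - 1 - j)) = ∑ j ∈ Finset.range (A - 2), (2 * j + 1) :=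
    Finset.sum_congr rfl fun j hj => by have := Finset.mem_range.1 hj; omega
  have e2 : ∑ j ∈ Finset.range (A - 1), (2 * A - 1 + j + 1 - (2 * A - 1 - j)) = ∑ j ∈ Finset.range (A - 1), (2 * j + 1) :=
    Finset.sum_congr rfl fun j hj => by have := Finset.mem_range.1 hj; omega
  rw [e1, e2, sum_range_odd, sum_range_odd]

/-- The types are exclusive: β and γ pairs are not of type κ, γ pairs are not of type β. [cite: MadrasSlade1993, §4.2, remark after Theorem 4.2.4 (p. 94)] -/
theorem fib_exclusive {A : ℕ} {t : ℕ × ℕ} (ht : t ∈ freePairs A) : (FibB A t → ¬ FibK A t) ∧ (FibG A t → ¬ FibK A t ∧ ¬ FibB A t) := by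
  obtain ⟨x, y⟩ := t
  rw [mem_freePairs] at ht
  simp only [FibK, FibB, FibG]
  omega

/-- ★ The sum of the fibre values over the free pairs, without division:
`2 Σ_t fibVal = κ·A(A−1) + β·4(A−1)² + γ·2((A−2)²+(A−1)²) + α·(the rest)`, the rest being `2·#freePairs − …`.
[cite: MadrasSlade1993, §4.2, remark after Theorem 4.2.4 (p. 94)] -/
theorem sum_fibVal (d A : ℕ) :
    ∑ t ∈ freePairs A, fibVal d A t =
      ((freePairs A).filter (FibK A)).card * (2 * d * (2 * d - 1) ^ 3) +
      ((freePairs A).filter (FibB A)).card * (2 * d * (2 * d * (2 * d - 1) ^ 2) - 2 * d * (2 * d - 2)) +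
      ((freePairs A).filter (FibG A)).card * ((2 * d * (2 * d - 1)) * (2 * d * (2 * d - 1)) - (2 * d * (2 * d - 1) + 2 * d * (2 * d - 2))) +
      ((freePairs A).card - ((freePairs A).filter (FibK A)).card - ((freePairs A).filter (FibB A)).card -
        ((freePairs A).filter (FibG A)).card) * (2 * d * (2 * d - 1) ^ 3 - 2 * d * (2 * d - 2)) := by
  classical
  set κ := 2 * d * (2 * d - 1) ^ 3
  set β := 2 * d * (2 * d * (2 * d - 1) ^ 2) - 2 * d * (2 * d - 2)
  set γ := (2 * d * (2 * d - 1)) * (2 * d * (2 * d - 1)) - (2 * d * (2 * d - 1) + 2 * d * (2 * d - 2))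
  set α := 2 * d * (2 * d - 1) ^ 3 - 2 * d * (2 * d - 2)
  set S := freePairs A
  set sK := S.filter (FibK A)
  set sB := S.filter (FibB A)
  set sG := S.filter (FibG A)
  set sA := S.filter fun t => ¬ FibK A t ∧ ¬ FibB A t ∧ ¬ FibG A t with hsA
  -- the value on each part
  have hsplit : ∑ t ∈ S, fibVal d A t = ∑ t ∈ sK, fibVal d A t + ∑ t ∈ sB, fibVal d A t + ∑ t ∈ sG, fibVal d A t + ∑ t ∈ sA, fibVal d A t := by
    have hU : S = sK ∪ sB ∪ sG ∪ sA := by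
      ext t
      simp only [Finset.mem_union, Finset.mem_filter, sK, sB, sG, hsA]
      tauto
    have hdKB : Disjoint sK sB := by
      rw [Finset.disjoint_left]; intro t h1 h2
      exact (fib_exclusive (Finset.mem_filter.1 h2).1).1 (Finset.mem_filter.1 h2).2 (Finset.mem_filter.1 h1).2
    have hdKBG : Disjoint (sK ∪ sB) sG := by
      rw [Finset.disjoint_left]; intro t h12 h3
      have hg := (fib_exclusive (Finset.mem_filter.1 h3).1).2 (Finset.mem_filter.1 h3).2
      rcases Finset.mem_union.1 h12 with h1 | h2
      · exact hg.1 (Finset.mem_filter.1 h1).2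
      · exact hg.2 (Finset.mem_filter.1 h2).2
    have hdA : Disjoint (sK ∪ sB ∪ sG) sA := by
      rw [Finset.disjoint_left]; intro t h123 h4
      obtain ⟨-, n1, n2, n3⟩ := Finset.mem_filter.1 h4
      rcases Finset.mem_union.1 h123 with h12 | h3
      · rcases Finset.mem_union.1 h12 with h1 | h2
        · exact n1 (Finset.mem_filter.1 h1).2
        · exact n2 (Finset.mem_filter.1 h2).2
      · exact n3 (Finset.mem_filter.1 h3).2
    conv_lhs => rw [hU]
    rw [Finset.sum_union hdA, Finset.sum_union hdKBG, Finset.sum_union hdKB]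
  have vK : ∀ t ∈ sK, fibVal d A t = κ := fun t ht => by
    have h := (Finset.mem_filter.1 ht).2; simp only [fibVal, if_pos h, κ]
  have vB : ∀ t ∈ sB, fibVal d A t = β := fun t ht => by
    have h := (Finset.mem_filter.1 ht).2
    simp only [fibVal, if_neg ((fib_exclusive (Finset.mem_filter.1 ht).1).1 h), if_pos h, β]
  have vG : ∀ t ∈ sG, fibVal d A t = γ := fun t ht => by
    have h := (Finset.mem_filter.1 ht).2
    obtain ⟨n1, n2⟩ := (fib_exclusive (Finset.mem_filter.1 ht).1).2 h
    simp only [fibVal, if_neg n1, if_neg n2, if_pos h, γ]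
  have vA : ∀ t ∈ sA, fibVal d A t = α := fun t ht => by
    obtain ⟨-, n1, n2, n3⟩ := Finset.mem_filter.1 ht
    simp only [fibVal, if_neg n1, if_neg n2, if_neg n3, α]
  have hcardA : sA.card = S.card - sK.card - sB.card - sG.card := by
    have h1 := Finset.card_union_of_disjoint (s := sK ∪ sB ∪ sG) (t := sA) (by
      rw [Finset.disjoint_left]; intro t h123 h4
      obtain ⟨-, n1, n2, n3⟩ := Finset.mem_filter.1 h4
      rcases Finset.mem_union.1 h123 with h12 | h3
      · rcases Finset.mem_union.1 h12 with h1 | h2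
        · exact n1 (Finset.mem_filter.1 h1).2
        · exact n2 (Finset.mem_filter.1 h2).2
      · exact n3 (Finset.mem_filter.1 h3).2)
    have h2 := Finset.card_union_of_disjoint (s := sK ∪ sB) (t := sG) (by
      rw [Finset.disjoint_left]; intro t h12 h3
      have hg := (fib_exclusive (Finset.mem_filter.1 h3).1).2 (Finset.mem_filter.1 h3).2
      rcases Finset.mem_union.1 h12 with h1 | h2
      · exact hg.1 (Finset.mem_filter.1 h1).2
      · exact hg.2 (Finset.mem_filter.1 h2).2)
    have h3 := Finset.card_union_of_disjoint (s := sK) (t := sB) (by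
      rw [Finset.disjoint_left]; intro t h1 h2
      exact (fib_exclusive (Finset.mem_filter.1 h2).1).1 (Finset.mem_filter.1 h2).2 (Finset.mem_filter.1 h1).2)
    have hU : S = sK ∪ sB ∪ sG ∪ sA := by
      ext t
      simp only [Finset.mem_union, Finset.mem_filter, sK, sB, sG, hsA]
      tauto
    have : S.card = sK.card + sB.card + sG.card + sA.card := by
      conv_lhs => rw [hU]
      rw [h1, h2, h3]
    omega
  rw [hsplit, Finset.sum_congr rfl vK, Finset.sum_congr rfl vB, Finset.sum_congr rfl vG, Finset.sum_congr rfl vA,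
    Finset.sum_const, Finset.sum_const, Finset.sum_const, Finset.sum_const, smul_eq_mul, smul_eq_mul, smul_eq_mul, smul_eq_mul,
    hcardA]


/-! ### The bump words: every block is realized, fibre `α` -/

/-- The bump word is injective on the segments of its four turn flats, and all four blocks are realized.
[cite: MadrasSlade1993, §4.2, remark after Theorem 4.2.4 (p. 94)] -/
theorem bump_facts {A P : ℕ} (hP : 2 ≤ P) (hPA : P + 1 ≤ A) :
    SegInj (bumpR A P) (3 * A - 2) (bumpF A P) ∧ Occ2 (bumpR A P) (3 * A - 2) (bumpF A P) 0 ∧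
      Occ2 (bumpR A P) (3 * A - 2) (bumpF A P) 1 ∧ Occ2 (bumpR A P) (3 * A - 2) (bumpF A P) 2 ∧
      Occ4 (bumpR A P) (3 * A - 2) (bumpF A P) := by
  refine ⟨?_, ⟨1, 2 * P - 1, ?_, ?_, ?_⟩, ⟨P, P + 2 * A - 2, ?_, ?_, ?_⟩, ⟨2 * P + A - 2, 3 * A - 2, ?_, ?_, ?_⟩,
    ⟨P, P + 2 * A - 2, ?_, ?_, ?_⟩⟩
  · intro c p q hp hq h
    rw [inSeg_iff] at hp hq
    simp only [bumpF] at hp hq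
    simp only [bumpR] at h
    split_ifs at h <;> omega
  all_goals first
    | (rw [inSeg_iff]; simp only [bumpF]; omega)
    | (simp only [bumpR]; split_ifs <;> omega)

open Classical in
/-- ★ The fibre of every bump word is `α = 2d(2d−1)³ − 2d(2d−2)`. [cite: MadrasSlade1993, §4.2, remark after Theorem 4.2.4 (p. 94)] -/
theorem card_admB (d : ℕ) {A P : ℕ} (hP : 2 ≤ P) (hPA : P + 1 ≤ A) :
    (admB d A P).card = 2 * d * (2 * d - 1) ^ 3 - 2 * d * (2 * d - 2) := by
  obtain ⟨hinj, o0, o1, o2, o4⟩ := bump_facts hP hPA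
  have heq : admB d A P = Finset.univ.filter (Good d (bumpR A P) (3 * A - 2) (bumpF A P)) := by
    ext u
    rw [mem_admB, Finset.mem_filter]
    simp only [Finset.mem_univ, true_and]
    exact mem_saws_iff_good (isFlats_bumpF hP hPA) (by omega) (isRedWord_bumpR hP hPA) hinj u
  rw [heq, card_filter_good_all o0 o1 o2 o4]

/-! ### Assembly: the closed form of the two-slack layer -/

/-- The layer as fibre values over the free pairs plus the bump words. [cite: MadrasSlade1993, §4.2, remark after Theorem 4.2.4 (p. 94)] -/
theorem costCoeffZd_eq_sum_fibVal (d : ℕ) {A : ℕ} (hA : 2 ≤ A) :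
    costCoeffZd d (2 * A + 2) (3 * A + 2) =
      ∑ t ∈ freePairs A, fibVal d A t + (A - 2) * (2 * d * (2 * d - 1) ^ 3 - 2 * d * (2 * d - 2)) := by
  rw [costCoeffZd_two_mul_add_two_eq_sum d hA, sum_stapleFlats_eq_sum_freePairs hA]
  congr 1
  · refine Finset.sum_congr rfl fun t ht => ?_
    obtain ⟨x, y⟩ := t
    exact card_admS_phi d hA ht
  · rw [Finset.sum_congr rfl fun P hP => card_admB d (Finset.mem_Icc.1 hP).1 (by have := (Finset.mem_Icc.1 hP).2; omega),
      Finset.sum_const, Nat.card_Icc, smul_eq_mul, show A - 1 + 1 - 2 = A - 2 by omega]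

/-- `β` in the registered form `κ + 2d(2d−1)(2d−2) + 2d`. [cite: MadrasSlade1993, §1.2] -/
theorem beta_forms (d : ℕ) :
    2 * d * (2 * d * (2 * d - 1) ^ 2) - 2 * d * (2 * d - 2) = 2 * d * (2 * d - 1) ^ 3 + 2 * d * (2 * d - 1) * (2 * d - 2) + 2 * d := by
  rcases d with _ | c
  · simp
  · have h1 : 2 * (c + 1) - 1 = 2 * c + 1 := by omega
    have h2 : 2 * (c + 1) - 2 = 2 * c := by omega
    rw [h1, h2]
    apply Nat.sub_eq_of_eq_add
    ring

/-- `γ` in the registered form `κ + 2d(2d−2)²`. [cite: MadrasSlade1993, §1.2] -/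
theorem gamma_forms (d : ℕ) :
    (2 * d * (2 * d - 1)) * (2 * d * (2 * d - 1)) - (2 * d * (2 * d - 1) + 2 * d * (2 * d - 2)) =
      2 * d * (2 * d - 1) ^ 3 + 2 * d * (2 * d - 2) ^ 2 := by
  rcases d with _ | c
  · simp
  · have h1 : 2 * (c + 1) - 1 = 2 * c + 1 := by omega
    have h2 : 2 * (c + 1) - 2 = 2 * c := by omega
    rw [h1, h2]
    apply Nat.sub_eq_of_eq_add
    ring

/-- ★★★ **The two-slack layer in closed form (lane FINDING (12), MINING-PREREG Am. AT «P-TWOSLACK»): for every `A ≥ 2` and every `d`,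
`N_{2A+2,3A+2}(ℤ^{d+1}) = (7A−8)·α + 2(A−1)²·β + ½A(A−1)·κ + (2A²−6A+5)·γ`** with `κ = 2d(2d−1)³`, `α = κ − 2d(2d−2)`,
`β = κ + 2d(2d−1)(2d−2) + 2d`, `γ = κ + 2d(2d−2)²` — stated doubled to avoid the division, and with `2A² + 5 − 6A` for `2A²−6A+5`.
[cite: MadrasSlade1993, §4.2, remark after Theorem 4.2.4 (p. 94)] -/
theorem two_mul_costCoeffZd_two_mul_add_two (d : ℕ) {A : ℕ} (hA : 2 ≤ A) :
    2 * costCoeffZd d (2 * A + 2) (3 * A + 2) =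
      2 * (7 * A - 8) * (2 * d * (2 * d - 1) ^ 3 - 2 * d * (2 * d - 2)) +
      4 * ((A - 1) * (A - 1)) * (2 * d * (2 * d - 1) ^ 3 + 2 * d * (2 * d - 1) * (2 * d - 2) + 2 * d) +
      A * (A - 1) * (2 * d * (2 * d - 1) ^ 3) +
      2 * (2 * A * A + 5 - 6 * A) * (2 * d * (2 * d - 1) ^ 3 + 2 * d * (2 * d - 2) ^ 2) := by
  rw [costCoeffZd_eq_sum_fibVal d hA, sum_fibVal d A, ← beta_forms, ← gamma_forms]
  set κ := 2 * d * (2 * d - 1) ^ 3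
  set α := 2 * d * (2 * d - 1) ^ 3 - 2 * d * (2 * d - 2)
  set β := 2 * d * (2 * d * (2 * d - 1) ^ 2) - 2 * d * (2 * d - 2)
  set γ := (2 * d * (2 * d - 1)) * (2 * d * (2 * d - 1)) - (2 * d * (2 * d - 1) + 2 * d * (2 * d - 2))
  have hW := two_mul_card_freePairs A
  have hK := two_mul_card_filter_fibK hA
  have hB := card_filter_fibB hA
  have hG := card_filter_fibG hA
  set W := (freePairs A).card
  set nK := ((freePairs A).filter (FibK A)).card
  set nB := ((freePairs A).filter (FibB A)).card
  set nG := ((freePairs A).filter (FibG A)).card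
  -- the arithmetic of the class counts, in terms of `B = A − 2`
  obtain ⟨B, rfl⟩ : ∃ B, A = B + 2 := ⟨A - 2, by omega⟩
  have e1 : B + 2 - 1 = B + 1 := by omega
  have e2 : B + 2 - 2 = B := by omega
  have e3 : 3 * (B + 2) - 2 = 3 * B + 4 := by omega
  have e4 : 3 * (B + 2) - 1 = 3 * B + 5 := by omega
  have e5 : 7 * (B + 2) - 8 = 7 * B + 6 := by omega
  have e6 : 2 * (B + 2) * (B + 2) + 5 - 6 * (B + 2) = 2 * B * B + 2 * B + 1 := by
    have : 2 * (B + 2) * (B + 2) + 5 = (2 * B * B + 2 * B + 1) + 6 * (B + 2) := by ring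
    omega
  rw [e3, e4] at hW
  rw [e1] at hK hB hG
  rw [e2] at hG
  rw [e1, e2, e5, e6]
  have hsum : W = nK + nB + nG + (6 * B + 6) := by
    have h2 : 2 * W = 2 * (nK + nB + nG + (6 * B + 6)) := by
      zify at hW hK hB hG ⊢
      linear_combination hW - hK - hB - 2 * hG
    omega
  have hrest : W - nK - nB - nG = 6 * B + 6 := by omega
  rw [hrest]
  zify at hK hB hG ⊢
  linear_combination (κ : ℤ) * hK + (β : ℤ) * hB + 2 * (γ : ℤ) * hG


/-- ★★★ **`N_{2A+2,3A+2}(ℤ^{d+1}) = (7A−8)·α + 2(A−1)²·β + ½A(A−1)·κ + (2A²−6A+5)·γ`** for every `A ≥ 2` and every `d` — the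
registered closed form of the two-slack layer (lane FINDING (12); `½A(A−1)` as `A(A−1)/2`, exact; `2A²−6A+5` as `2A² + 5 − 6A`).
With STAPLES (`N_{2A,3A} = 2d(2d−1)`) and SUB-STAPLES (`N_{2A+1,3A+1} = (3A−2)·2d(2d−1)²`) the three top coefficients of every cost
polynomial of the pulled large-force expansion are closed forms. [cite: MadrasSlade1993, §4.2, remark after Theorem 4.2.4 (p. 94)] -/
theorem costCoeffZd_two_mul_add_two_three_mul_add_two (d : ℕ) {A : ℕ} (hA : 2 ≤ A) :
    costCoeffZd d (2 * A + 2) (3 * A + 2) =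
      (7 * A - 8) * (2 * d * (2 * d - 1) ^ 3 - 2 * d * (2 * d - 2)) +
      2 * ((A - 1) * (A - 1)) * (2 * d * (2 * d - 1) ^ 3 + 2 * d * (2 * d - 1) * (2 * d - 2) + 2 * d) +
      A * (A - 1) / 2 * (2 * d * (2 * d - 1) ^ 3) +
      (2 * A * A + 5 - 6 * A) * (2 * d * (2 * d - 1) ^ 3 + 2 * d * (2 * d - 2) ^ 2) := by
  have h := two_mul_costCoeffZd_two_mul_add_two d hA
  have heven : A * (A - 1) / 2 * 2 = A * (A - 1) := by
    obtain ⟨n, rfl⟩ : ∃ n, A = n + 1 := ⟨A - 1, by omega⟩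
    rw [Nat.add_sub_cancel, mul_comm (n + 1) n]
    exact Nat.div_mul_cancel (even_iff_two_dvd.1 (Nat.even_mul_succ_self n))
  set α := 2 * d * (2 * d - 1) ^ 3 - 2 * d * (2 * d - 2)
  set β := 2 * d * (2 * d - 1) ^ 3 + 2 * d * (2 * d - 1) * (2 * d - 2) + 2 * d
  set κ := 2 * d * (2 * d - 1) ^ 3
  set γ := 2 * d * (2 * d - 1) ^ 3 + 2 * d * (2 * d - 2) ^ 2
  set P := 7 * A - 8
  set Q := (A - 1) * (A - 1)
  set S := 2 * A * A + 5 - 6 * A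
  set m := A * (A - 1) / 2
  rw [← heven] at h
  have h2 : 2 * costCoeffZd d (2 * A + 2) (3 * A + 2) = 2 * (P * α + 2 * Q * β + m * κ + S * γ) := by rw [h]; ring
  omega


/-- ★ **`N_{6,8}(ℤ^{d+1}) = 160d⁴ − 216d³ + 56d² + 24d`** (the case `A = 2`: `6α + 2β + κ + γ`; census: 24, 1104, 7704, 28128, 74520 for
`d = 1, …, 5`) — the two-slack ingredient of the sixth coefficient `c₆^{(d)}`. [cite: MadrasSlade1993, §4.2, remark after Theorem 4.2.4 (p. 94)] -/
theorem costCoeffZd_six_eight (d : ℕ) : costCoeffZd d 6 8 = 160 * d ^ 4 + 56 * d ^ 2 + 24 * d - 216 * d ^ 3 := by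
  have h := costCoeffZd_two_mul_add_two_three_mul_add_two d (A := 2) le_rfl
  norm_num at h
  rw [h]
  rcases d with _ | c
  · simp
  · have e1 : 2 * (c + 1) - 1 = 2 * c + 1 := by omega
    have e2 : 2 * (c + 1) - 2 = 2 * c := by omega
    rw [e1, e2]
    have hle1 : 2 * (c + 1) * (2 * c) ≤ 2 * (c + 1) * (2 * c + 1) ^ 3 :=
      Nat.mul_le_mul_left _ (le_trans (Nat.le_succ _) (Nat.le_self_pow (by norm_num) _))
    have hle2 : 216 * (c + 1) ^ 3 ≤ 160 * (c + 1) ^ 4 + 56 * (c + 1) ^ 2 + 24 * (c + 1) := by nlinarith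
    zify [hle1, hle2]
    ring

end TwoSlack

end Literature.Probability.RandomPlanarGeometry.SAW.Zd

end
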